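import Mathlib.RingTheory.Polynomial.Resultant.Basic
import Mathlib.RingTheory.Polynomial.GaussLemma
import Mathlib.RingTheory.UniqueFactorizationDomain.GCDMonoid
import Mathlib.Algebra.Polynomial.Degree.SmallDegree
import Mathlib.FieldTheory.Finite.GaloisField
import Mathlib.FieldTheory.Finite.Polynomial
import Mathlib.LinearAlgebra.Basis.VectorSpace
import Literature.RingTheory.MvPolynomial.NoetherFormsBertini
import Literature.Computability.AlgebraicComplexity.KaltofenHenselLifting
import Literature.Computability.AlgebraicComplexity.KaltofenFactorClosureProofs
import Literature.Computability.AlgebraicComplexity.RazElusiveGeneralRouteProofs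
import HarnessLib

/-!
# Kaltofen's factor theorem in positive characteristic: `L(g^{p^e}) ≤ poly(n, L(f), deg f)`
# for an irreducible factor `g` of exact multiplicity `p^e · j`, `p ∤ j`, over `𝔽_p` — PROVED

Topic `Computability/AlgebraicComplexity`. This file proves, as the theorem
`kaltofenFactorBound_primeChar`, exactly the statement typed in the tree as the named fact
`Literature.Barriers.ValiantsHypothesis.BIJL2018_thm24` (Bläser–Ikenmeyer–Jindal–Lysikov 2018,
Thm. 24 = Kaltofen [Kal89] over `𝔽_p`, circuit-existence content): there is an absolute `κ` with
`L(g^{p^e}) ≤ (n + L(f) + deg f + log₂ p + 2)^κ` whenever `f ∈ 𝔽_p[x_1, …, x_n]` is nonzero,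
`g` is irreducible, `p ∤ j`, and `g^{p^e j} ∥ f` (`L = complexity`, fan-in-two circuit size with
free constants). The discharge `BIJL2018_thm24_holds` is the one-line file
`Barriers/ValiantsHypothesis/BIJL18Thm24Holds.lean`. Honest framing: a 1986/1989 theorem of
Kaltofen formalised; nothing here bears on `VP ≠ VNP`, which is NOT proved.

## The proof (Kaltofen 1986, §2: "If char(F) = p divides any of the eᵢ, say eᵢ = p^êᵢ e'ᵢ with
e'ᵢ not divisible by p, we replace eᵢ by e'ᵢ and g̃ᵢ by g̃ᵢ^{p^êᵢ}" — then Hensel lifting)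

Write `q = p^e`, `N = q j`, `f = g^N h`, `g ∤ h`, `V = g^q` (the target), `δ = deg g`,
`η = deg h`, `d = deg f = N δ + η`.
1. **Genericity polynomial over `𝔽_p`** (§ `SymbolicShear`, any field `K`): substitute the
   SYMBOLIC line `xᵢ ↦ bᵢ + aᵢ Y` (`2n` new variables): `𝒢(Y) = g(b + aY)`,
   `ℋ(Y) = h(b + aY) ∈ K[a, b][Y]`. Then `𝒢` is irreducible (it is `g` renamed, moved by the
   automorphism `bᵢ ↦ bᵢ + aᵢ Y`), primitive of `Y`-degree `δ` with leading coefficient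
   `g_δ(a)`, so by Gauss's lemma (`Polynomial.IsPrimitive.irreducible_iff_irreducible_map_fraction_map`)
   and `g ∤ h` the resultant `ℛ = Res_Y(𝒢, ℋ) ∈ K[a, b]` is NONZERO
   (`resultant_symShear_ne_zero`); its total degree is `≤ 2(δ + η)²`. The genericity
   polynomial is `𝔊 = g_δ(a) · h_η(a) · g(b) · ℛ(a, b) ≠ 0`, `deg 𝔊 ≤ 2(d+1)²`.
2. **A good point in a finite extension** (§ `GoodPoint`): in `𝕃 = GaloisField p k` with
   `p^k > 2(d+1)²` a point `(a₀, b₀) ∈ 𝕃^{2n}` with `𝔊(a₀, b₀) ≠ 0` exists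
   (`MvPolynomial.eq_zero_of_eval_eq_zero`); there `g_δ(a₀) h_η(a₀) ≠ 0`, `g(b₀) ≠ 0`, and
   `Y ↦ g(b₀ + a₀Y)`, `Y ↦ h(b₀ + a₀Y)` are coprime in `𝕃[Y]` (`Polynomial.resultant_map_map`,
   `Polynomial.resultant_eq_zero_iff`).
3. **Hensel** (§ `Assembly`): after `xᵢ ↦ xᵢ + b₀ᵢ + a₀ᵢ y` over `𝕃`, `f = c · P · Q` with
   `P = (g/g_δ(a₀))^N`, `Q = h/h_η(a₀)` monic in `y` and `P(0, Y)`, `Q(0, Y)` coprime, so the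
   engine `KaltofenHensel.complexity_le_of_coprimeFactors` (nodes: any `d` elements of `𝕃`)
   bounds `L(P̂)`, `P̂ = P` read in `𝕃[x, y]`.
4. **`j`-th root**: `P̂ = W^j` with `W = (g/g_δ(a₀))^q(x + b₀ + a₀y)`, `W(0) ≠ 0`, `p ∤ j`:
   the root `W` of `Z^j − P̂` is simple at the origin, so `KaltofenFactor.complexity_le_of_rootData`
   (with `P = Z − W`, `S = {W(0)}`) bounds `L(W)`; undoing the substitution bounds
   `L_𝕃(g^q)`.
5. **Descent to `𝔽_p`**: `g^q` has coefficients in `𝔽_p`; a circuit over `𝕃` is simulated over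
   `𝔽_p` at cost `O(k³)` (`CommExtSim.complexity_lmap_le`, Hrubeš–Yehudayoff, with a linear
   functional `φ : 𝕃 → 𝔽_p`, `φ(1) = 1`), and `k = O(log d)`.
All bounds are polynomial in `n, L(f), d`; the final exponent is generous.

## References

* [Kaltofen1986] E. Kaltofen, *Uniform closure properties of P-computable functions*, STOC 1986,
  §2 (Algorithm Factorization; the positive-characteristic replacement on p. 334; Steps H/L).
* [Kaltofen1989] E. Kaltofen, *Factorization of polynomials given by straight-line programs*,
  in: Randomness and Computation, JAI Press 1989.
* [BlaserIkenmeyerJindalLysikov2018] Thm. 24 (the typed statement).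
* [HrubesYehudayoff2011] Thm 4.2 (simulation of extension-field arithmetic).
-/

noncomputable section

namespace Literature.Computability.AlgebraicComplexity

open MvPolynomial Finset

namespace KaltofenPosChar

/-! ### The symbolic shear `xᵢ ↦ bᵢ + aᵢ Y` and its resultant -/

section SymbolicShear

variable {K : Type*} [Field K] {n : ℕ}

/-- **The symbolic shear** `xᵢ ↦ bᵢ + aᵢ · Y` into `K[a, b][Y]` (`a = inl`, `b = inr`), the
substitution of a generic line used to reduce multivariate to univariate factorisation
(Kaltofen 1986, §2, Step R). PLUMBING DEFINITION with body.
[cite: Kaltofen1986, §2 (Algorithm Factorization, the substitution x ↦ b x₁ + a)] -/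
def symShear (K : Type*) [Field K] (n : ℕ) :
    MvPolynomial (Fin n) K →ₐ[K] Polynomial (MvPolynomial (Fin n ⊕ Fin n) K) :=
  aeval fun i : Fin n => Polynomial.C (X (Sum.inl i)) * Polynomial.X + Polynomial.C (X (Sum.inr i))

/-- The symbolic shear on a variable. [folklore] -/
private theorem symShear_X (i : Fin n) : symShear K n (X i) =
    Polynomial.C (X (Sum.inl i)) * Polynomial.X + Polynomial.C (X (Sum.inr i)) := by
  rw [symShear, aeval_X]

/-- The automorphism `bᵢ ↦ bᵢ + aᵢ Y` of `K[Y, a, b]` (forward substitution). [folklore] -/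
private def twistFwd (K : Type*) [Field K] (n : ℕ) :
    MvPolynomial (Option (Fin n ⊕ Fin n)) K →ₐ[K] MvPolynomial (Option (Fin n ⊕ Fin n)) K :=
  aeval fun o : Option (Fin n ⊕ Fin n) => o.elim (X none) fun s => Sum.elim
    (fun i => X (some (Sum.inl i)))
    (fun i => X (some (Sum.inr i)) + X (some (Sum.inl i)) * X none) s

/-- The inverse substitution `bᵢ ↦ bᵢ − aᵢ Y`. [folklore] -/
private def twistBwd (K : Type*) [Field K] (n : ℕ) :
    MvPolynomial (Option (Fin n ⊕ Fin n)) K →ₐ[K] MvPolynomial (Option (Fin n ⊕ Fin n)) K :=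
  aeval fun o : Option (Fin n ⊕ Fin n) => o.elim (X none) fun s => Sum.elim
    (fun i => X (some (Sum.inl i)))
    (fun i => X (some (Sum.inr i)) - X (some (Sum.inl i)) * X none) s

/-- The backward twist undoes the forward twist. [folklore] -/
private theorem twistBwd_comp_twistFwd :
    (twistBwd K n).comp (twistFwd K n) = AlgHom.id K _ := by
  refine MvPolynomial.algHom_ext fun o => ?_
  rcases o with _ | s
  · simp [twistFwd, twistBwd]
  · rcases s with i | i
    · simp [twistFwd, twistBwd]
    · simp only [twistFwd, twistBwd, AlgHom.comp_apply, aeval_X, Option.elim_some, Sum.elim_inr,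
        map_add, map_mul, Option.elim_none, Sum.elim_inl, AlgHom.id_apply]
      ring

/-- The forward twist undoes the backward twist. [folklore] -/
private theorem twistFwd_comp_twistBwd :
    (twistFwd K n).comp (twistBwd K n) = AlgHom.id K _ := by
  refine MvPolynomial.algHom_ext fun o => ?_
  rcases o with _ | s
  · simp [twistFwd, twistBwd]
  · rcases s with i | i
    · simp [twistFwd, twistBwd]
    · simp only [twistFwd, twistBwd, AlgHom.comp_apply, aeval_X, Option.elim_some, Sum.elim_inr,
        map_sub, map_mul, Option.elim_none, Sum.elim_inl, AlgHom.id_apply]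
      ring

/-- The twist as an algebra automorphism. [folklore] -/
private def twistEquiv (K : Type*) [Field K] (n : ℕ) :
    MvPolynomial (Option (Fin n ⊕ Fin n)) K ≃ₐ[K] MvPolynomial (Option (Fin n ⊕ Fin n)) K :=
  AlgEquiv.ofAlgHom (twistFwd K n) (twistBwd K n) twistFwd_comp_twistBwd twistBwd_comp_twistFwd

/-- **The symbolic shear factors as rename ∘ automorphism ∘ `optionEquivLeft`.** [folklore] -/
private theorem symShear_eq (φ : MvPolynomial (Fin n) K) :
    symShear K n φ = optionEquivLeft K (Fin n ⊕ Fin n)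
      (twistFwd K n (rename (fun i : Fin n => (some (Sum.inr i) : Option (Fin n ⊕ Fin n))) φ)) := by
  have key : symShear K n = ((optionEquivLeft K (Fin n ⊕ Fin n) :
      MvPolynomial (Option (Fin n ⊕ Fin n)) K →ₐ[K] Polynomial (MvPolynomial (Fin n ⊕ Fin n) K)).comp
        ((twistFwd K n).comp
          (rename fun i : Fin n => (some (Sum.inr i) : Option (Fin n ⊕ Fin n))))) := by
    refine MvPolynomial.algHom_ext fun i => ?_
    rw [AlgHom.comp_apply, AlgHom.comp_apply, symShear_X, rename_X]
    simp only [twistFwd, aeval_X, Option.elim_some, Sum.elim_inr, map_add, map_mul]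
    erw [optionEquivLeft_X_some, optionEquivLeft_X_some, optionEquivLeft_X_none]
    ring
  exact AlgHom.congr_fun key φ

/-- The top homogeneous component of a nonzero polynomial is nonzero. [folklore] -/
private theorem homogeneousComponent_totalDegree_ne_zero {σ : Type*} {p : MvPolynomial σ K}
    (hp : p ≠ 0) : homogeneousComponent p.totalDegree p ≠ 0 := by
  classical
  obtain ⟨m, hm, hmax⟩ := Finset.exists_mem_eq_sup p.support
    (MvPolynomial.support_nonempty.2 hp) (fun s : σ →₀ ℕ => s.sum fun _ e => e)
  have hdeg : m.degree = p.totalDegree := by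
    rw [MvPolynomial.totalDegree, hmax, Finsupp.degree_apply]
    rfl
  intro h
  have := congrArg (coeff m) h
  rw [coeff_homogeneousComponent, if_pos hdeg, coeff_zero] at this
  exact (mem_support_iff.1 hm) this

/-- Projection killing `Y` and the `a`'s and sending `bᵢ ↦ xᵢ` (a left inverse of the renaming).
[folklore] -/
private def projB (K : Type*) [Field K] (n : ℕ) :
    MvPolynomial (Option (Fin n ⊕ Fin n)) K →ₐ[K] MvPolynomial (Fin n) K :=
  aeval fun o : Option (Fin n ⊕ Fin n) => o.elim 0 fun s => Sum.elim (fun _ => 0) X s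

/-- The projection is a left inverse of the renaming. [folklore] -/
private theorem projB_rename (φ : MvPolynomial (Fin n) K) :
    projB K n (rename (fun i : Fin n => (some (Sum.inr i) : Option (Fin n ⊕ Fin n))) φ) = φ := by
  rw [projB, aeval_rename]
  have : ((fun o : Option (Fin n ⊕ Fin n) => o.elim (0 : MvPolynomial (Fin n) K)
      fun s => Sum.elim (fun _ => 0) X s) ∘ fun i : Fin n => (some (Sum.inr i))) = X := by
    funext i; simp
  rw [this, aeval_X_left_apply]

/-- **The symbolic shear preserves irreducibility.** [cite: Kaltofen1986, §2 (Step R and the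
effective Hilbert irreducibility theorem invoked there)] -/
theorem irreducible_symShear {g : MvPolynomial (Fin n) K} (hg : Irreducible g) :
    Irreducible (symShear K n g) := by
  rw [symShear_eq]
  have h1 : Irreducible (rename (fun i : Fin n => (some (Sum.inr i) : Option (Fin n ⊕ Fin n))) g) :=
    Literature.RingTheory.MvPolynomial.NoetherForms.irreducible_rename
      (fun i j h => by simpa using h) hg
  have h2 : Irreducible (twistFwd K n
      (rename (fun i : Fin n => (some (Sum.inr i) : Option (Fin n ⊕ Fin n))) g)) :=
    (MulEquiv.irreducible_iff (twistEquiv K n).toMulEquiv).2 h1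
  exact (MulEquiv.irreducible_iff (optionEquivLeft K (Fin n ⊕ Fin n)).toMulEquiv).2 h2

/-- **Divisibility pulls back along the symbolic shear.** [folklore] -/
private theorem dvd_of_symShear_dvd {g h : MvPolynomial (Fin n) K} (hdvd : symShear K n g ∣ symShear K n h) :
    g ∣ h := by
  rw [symShear_eq, symShear_eq] at hdvd
  have h1 := (map_dvd_iff (optionEquivLeft K (Fin n ⊕ Fin n)).toMulEquiv).1 hdvd
  have h2 : rename (fun i : Fin n => (some (Sum.inr i) : Option (Fin n ⊕ Fin n))) g ∣
      rename (fun i : Fin n => (some (Sum.inr i) : Option (Fin n ⊕ Fin n))) h :=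
    (map_dvd_iff (twistEquiv K n).toMulEquiv).1 h1
  have h3 := map_dvd (projB K n) h2
  rwa [projB_rename, projB_rename] at h3

/-! #### Degree and leading coefficient of the sheared polynomial -/

/-- The product of the linear factors for a monomial `x^m`. [folklore] -/
private theorem natDegree_prod_linear_le (m : Fin n →₀ ℕ) :
    (∏ i ∈ m.support, (Polynomial.C (X (Sum.inl i)) * Polynomial.X +
      Polynomial.C (X (Sum.inr i)) : Polynomial (MvPolynomial (Fin n ⊕ Fin n) K)) ^ m i).natDegree
        ≤ m.degree := by
  refine (Polynomial.natDegree_prod_le _ _).trans ?_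
  rw [Finsupp.degree_apply]
  refine Finset.sum_le_sum fun i _ => (Polynomial.natDegree_pow_le).trans ?_
  calc m i * (Polynomial.C (X (Sum.inl i)) * Polynomial.X + Polynomial.C (X (Sum.inr i)) :
        Polynomial (MvPolynomial (Fin n ⊕ Fin n) K)).natDegree ≤ m i * 1 :=
        Nat.mul_le_mul_left _ Polynomial.natDegree_linear_le
    _ = m i := mul_one _

/-- Exact degree and leading coefficient of the product of linear factors. [folklore] -/
private theorem natDegree_prod_linear_eq (m : Fin n →₀ ℕ) :
    (∏ i ∈ m.support, (Polynomial.C (X (Sum.inl i)) * Polynomial.X +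
      Polynomial.C (X (Sum.inr i)) : Polynomial (MvPolynomial (Fin n ⊕ Fin n) K)) ^ m i).natDegree
        = m.degree ∧
    (∏ i ∈ m.support, (Polynomial.C (X (Sum.inl i)) * Polynomial.X +
      Polynomial.C (X (Sum.inr i)) : Polynomial (MvPolynomial (Fin n ⊕ Fin n) K)) ^ m i).leadingCoeff
        = ∏ i ∈ m.support, X (Sum.inl i) ^ m i := by
  have hlin : ∀ i : Fin n, (Polynomial.C (X (Sum.inl i)) * Polynomial.X +
      Polynomial.C (X (Sum.inr i)) : Polynomial (MvPolynomial (Fin n ⊕ Fin n) K)).natDegree = 1 ∧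
      (Polynomial.C (X (Sum.inl i)) * Polynomial.X + Polynomial.C (X (Sum.inr i)) :
        Polynomial (MvPolynomial (Fin n ⊕ Fin n) K)).leadingCoeff = X (Sum.inl i) := fun i =>
    ⟨Polynomial.natDegree_linear (X_ne_zero _), Polynomial.leadingCoeff_linear (X_ne_zero _)⟩
  have hpow : ∀ i : Fin n, ((Polynomial.C (X (Sum.inl i)) * Polynomial.X +
      Polynomial.C (X (Sum.inr i)) : Polynomial (MvPolynomial (Fin n ⊕ Fin n) K)) ^ m i).natDegree
        = m i ∧
      ((Polynomial.C (X (Sum.inl i)) * Polynomial.X + Polynomial.C (X (Sum.inr i)) :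
        Polynomial (MvPolynomial (Fin n ⊕ Fin n) K)) ^ m i).leadingCoeff = X (Sum.inl i) ^ m i := by
    intro i
    have hne : (Polynomial.C (X (Sum.inl i)) * Polynomial.X + Polynomial.C (X (Sum.inr i)) :
        Polynomial (MvPolynomial (Fin n ⊕ Fin n) K)).leadingCoeff ^ m i ≠ 0 := by
      rw [(hlin i).2]; exact pow_ne_zero _ (X_ne_zero _)
    rw [Polynomial.natDegree_pow' hne, Polynomial.leadingCoeff_pow' hne, (hlin i).1, (hlin i).2,
      mul_one]
    exact ⟨rfl, rfl⟩
  have hne : ∏ i ∈ m.support, ((Polynomial.C (X (Sum.inl i)) * Polynomial.X +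
      Polynomial.C (X (Sum.inr i)) : Polynomial (MvPolynomial (Fin n ⊕ Fin n) K)) ^ m i).leadingCoeff
        ≠ 0 := by
    rw [Finset.prod_ne_zero_iff]
    intro i _
    rw [(hpow i).2]; exact pow_ne_zero _ (X_ne_zero _)
  refine ⟨?_, ?_⟩
  · rw [Polynomial.natDegree_prod' _ _ hne, Finsupp.degree_apply]
    exact Finset.sum_congr rfl fun i _ => (hpow i).1
  · rw [Polynomial.leadingCoeff_prod' _ _ hne]
    exact Finset.prod_congr rfl fun i _ => (hpow i).2

/-- Expansion of the symbolic shear along the monomials. [folklore] -/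
private theorem symShear_eq_sum (φ : MvPolynomial (Fin n) K) :
    symShear K n φ = ∑ m ∈ φ.support, Polynomial.C (C (coeff m φ)) *
      ∏ i ∈ m.support, (Polynomial.C (X (Sum.inl i)) * Polynomial.X +
        Polynomial.C (X (Sum.inr i))) ^ m i := by
  conv_lhs => rw [φ.as_sum, map_sum]
  refine Finset.sum_congr rfl fun m _ => ?_
  rw [symShear, aeval_monomial, Polynomial.algebraMap_apply, algebraMap_eq]
  simp only [Finsupp.prod]

/-- **Degree of the sheared polynomial**: `deg_Y g(b + aY) ≤ deg g`.
[cite: Kaltofen1986, §2 (Step R)] -/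
theorem natDegree_symShear_le (φ : MvPolynomial (Fin n) K) :
    (symShear K n φ).natDegree ≤ φ.totalDegree := by
  rw [symShear_eq_sum]
  refine Polynomial.natDegree_sum_le_of_forall_le (s := φ.support)
    (fun m => Polynomial.C (C (coeff m φ)) *
      ∏ i ∈ m.support, (Polynomial.C (X (Sum.inl i)) * Polynomial.X +
        Polynomial.C (X (Sum.inr i)) : Polynomial (MvPolynomial (Fin n ⊕ Fin n) K)) ^ m i)
    (fun m hm => ?_)
  refine (Polynomial.natDegree_C_mul_le _ _).trans ((natDegree_prod_linear_le (K := K) m).trans ?_)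
  have := le_totalDegree hm
  rwa [Finsupp.degree]

/-- **Leading coefficient of the sheared polynomial**: the `Y^{deg g}`-coefficient of
`g(b + aY)` is `g_{deg g}(a)` (the top homogeneous component at `a`).
[cite: Kaltofen1986, §2 (Step R)] -/
theorem coeff_symShear_totalDegree (φ : MvPolynomial (Fin n) K) :
    (symShear K n φ).coeff φ.totalDegree =
      rename Sum.inl (homogeneousComponent φ.totalDegree φ) := by
  classical
  rw [symShear_eq_sum, Polynomial.finsetSum_coeff, homogeneousComponent_apply, map_sum]
  rw [← Finset.sum_filter_add_sum_filter_not φ.support (fun m => m.degree = φ.totalDegree)]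
  have hzero : ∑ m ∈ φ.support.filter (fun m => ¬ m.degree = φ.totalDegree),
      (Polynomial.C (C (coeff m φ)) * ∏ i ∈ m.support, (Polynomial.C (X (Sum.inl i)) * Polynomial.X +
        Polynomial.C (X (Sum.inr i))) ^ m i).coeff φ.totalDegree = 0 := by
    refine Finset.sum_eq_zero fun m hm => ?_
    rw [Finset.mem_filter] at hm
    have hlt : m.degree < φ.totalDegree := by
      have := le_totalDegree hm.1
      rw [Finsupp.degree]
      exact lt_of_le_of_ne this (by rw [← Finsupp.degree]; exact hm.2)
    rw [Polynomial.coeff_C_mul, Polynomial.coeff_eq_zero_of_natDegree_lt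
      ((natDegree_prod_linear_le (K := K) m).trans_lt hlt), mul_zero]
  rw [hzero, add_zero]
  refine Finset.sum_congr rfl fun m hm => ?_
  rw [Finset.mem_filter] at hm
  rw [Polynomial.coeff_C_mul, ← hm.2, ← (natDegree_prod_linear_eq (K := K) m).1,
    Polynomial.coeff_natDegree, (natDegree_prod_linear_eq (K := K) m).2, rename_monomial, monomial_eq,
    Finsupp.prod_mapDomain_index_inj Sum.inl_injective]
  simp only [Finsupp.prod]

/-- **The sheared polynomial has exact degree `deg g` and leading coefficient `g_{deg g}(a)`.**
[cite: Kaltofen1986, §2 (Step R)] -/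
theorem natDegree_symShear (φ : MvPolynomial (Fin n) K) (hφ : φ ≠ 0) :
    (symShear K n φ).natDegree = φ.totalDegree ∧
      (symShear K n φ).leadingCoeff = rename Sum.inl (homogeneousComponent φ.totalDegree φ) := by
  have hne : (symShear K n φ).coeff φ.totalDegree ≠ 0 := by
    rw [coeff_symShear_totalDegree]
    exact fun h => homogeneousComponent_totalDegree_ne_zero hφ
      (rename_injective _ Sum.inl_injective (by rw [h, map_zero]))
  have hdeg : (symShear K n φ).natDegree = φ.totalDegree :=
    le_antisymm (natDegree_symShear_le φ) (Polynomial.le_natDegree_of_ne_zero hne)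
  refine ⟨hdeg, ?_⟩
  rw [Polynomial.leadingCoeff, hdeg, coeff_symShear_totalDegree]

/-! #### Total degree (in `a, b`) of the coefficients -/

/-- Coefficients of `Φ Ψ` when those of `Φ`, `Ψ` have total degree `≤ D₁`, `≤ D₂`. [folklore] -/
private theorem coeffDeg_mul {τ : Type*} {Φ Ψ : Polynomial (MvPolynomial τ K)} {D₁ D₂ : ℕ}
    (hΦ : ∀ i, (Φ.coeff i).totalDegree ≤ D₁) (hΨ : ∀ i, (Ψ.coeff i).totalDegree ≤ D₂) (i : ℕ) :
    ((Φ * Ψ).coeff i).totalDegree ≤ D₁ + D₂ := by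
  rw [Polynomial.coeff_mul]
  refine (totalDegree_finsetSum _ _).trans (Finset.sup_le fun x _ => ?_)
  exact (totalDegree_mul _ _).trans (add_le_add (hΦ _) (hΨ _))

/-- Coefficients of `Φ ^ k`. [folklore] -/
private theorem coeffDeg_pow {τ : Type*} {Φ : Polynomial (MvPolynomial τ K)} {D : ℕ}
    (hΦ : ∀ i, (Φ.coeff i).totalDegree ≤ D) (k : ℕ) (i : ℕ) :
    ((Φ ^ k).coeff i).totalDegree ≤ k * D := by
  induction k generalizing i with
  | zero =>
    rw [pow_zero, Polynomial.coeff_one, zero_mul]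
    split_ifs <;> simp
  | succ k ih =>
    rw [pow_succ, Nat.succ_mul]
    exact coeffDeg_mul ih hΦ i

/-- Coefficients of a finite product. [folklore] -/
private theorem coeffDeg_prod {τ ι : Type*} (s : Finset ι)
    {Φ : ι → Polynomial (MvPolynomial τ K)} {D : ι → ℕ}
    (hΦ : ∀ a ∈ s, ∀ i, ((Φ a).coeff i).totalDegree ≤ D a) (i : ℕ) :
    ((∏ a ∈ s, Φ a).coeff i).totalDegree ≤ ∑ a ∈ s, D a := by
  classical
  induction s using Finset.induction_on generalizing i with
  | empty =>
    rw [Finset.prod_empty, Finset.sum_empty, Polynomial.coeff_one]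
    split_ifs <;> simp
  | insert a s ha ih =>
    rw [Finset.prod_insert ha, Finset.sum_insert ha]
    exact coeffDeg_mul (hΦ a (Finset.mem_insert_self _ _))
      (fun i => ih (fun a' ha' => hΦ a' (Finset.mem_insert_of_mem ha')) i) i

/-- **The coefficients of `g(b + aY)` have total degree `≤ deg g` in `a, b`.**
[cite: Kaltofen1986, §2 (Step R)] -/
theorem totalDegree_coeff_symShear_le (φ : MvPolynomial (Fin n) K) (i : ℕ) :
    ((symShear K n φ).coeff i).totalDegree ≤ φ.totalDegree := by
  classical
  rw [symShear_eq_sum, Polynomial.finsetSum_coeff]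
  refine (totalDegree_finsetSum _ _).trans (Finset.sup_le fun m hm => ?_)
  rw [Polynomial.coeff_C_mul]
  refine (totalDegree_mul _ _).trans ?_
  rw [totalDegree_C, zero_add]
  have hlin : ∀ a ∈ m.support, ∀ i, ((Polynomial.C (X (Sum.inl a)) * Polynomial.X +
      Polynomial.C (X (Sum.inr a)) : Polynomial (MvPolynomial (Fin n ⊕ Fin n) K)).coeff i).totalDegree
        ≤ 1 := by
    intro a _ i
    rw [Polynomial.coeff_add, Polynomial.coeff_C_mul, Polynomial.coeff_C, Polynomial.coeff_X]
    refine (totalDegree_add _ _).trans (max_le ?_ ?_)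
    · split_ifs
      · rw [mul_one, totalDegree_X]
      · rw [mul_zero, totalDegree_zero]; exact Nat.zero_le _
    · split_ifs
      · rw [totalDegree_X]
      · rw [totalDegree_zero]; exact Nat.zero_le _
  have hpow : ∀ a ∈ m.support, ∀ i, (((Polynomial.C (X (Sum.inl a)) * Polynomial.X +
      Polynomial.C (X (Sum.inr a)) : Polynomial (MvPolynomial (Fin n ⊕ Fin n) K)) ^ m a).coeff i).totalDegree
        ≤ m a := fun a ha i => by
    have := coeffDeg_pow (hlin a ha) (m a) i
    rwa [mul_one] at this
  refine (coeffDeg_prod m.support hpow i).trans ?_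
  have := le_totalDegree hm
  rwa [Finsupp.sum] at this

/-! #### The resultant is nonzero -/

/-- Total degree of a resultant from coefficient bounds (copy of the tree's
`totalDegree_resultant_le_of_coeffDeg`, `HypersurfaceFlecnodeNumerators.lean`). [folklore] -/
private theorem totalDegree_resultant_le {τ : Type*} {P Q : Polynomial (MvPolynomial τ K)}
    {A B : ℕ} (hP : ∀ i, (P.coeff i).totalDegree ≤ A) (hQ : ∀ i, (Q.coeff i).totalDegree ≤ B)
    (m k : ℕ) : (Polynomial.resultant P Q m k).totalDegree ≤ k * A + m * B := by
  classical
  rw [Polynomial.resultant, Matrix.det_apply]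
  refine (totalDegree_finsetSum _ _).trans (Finset.sup_le fun π _ => ?_)
  refine (totalDegree_smul_le _ _).trans ?_
  refine (totalDegree_finsetProd _ _).trans ?_
  have hentry : ∀ (i j : Fin (m + k)), (Polynomial.sylvester P Q m k i j).totalDegree ≤
      Fin.addCases (fun _ => B) (fun _ => A) j := by
    intro i j
    rw [Polynomial.sylvester, Matrix.of_apply]
    induction j using Fin.addCases with
    | left j =>
      rw [Fin.addCases_left, Fin.addCases_left]
      split_ifs
      · exact hQ _
      · rw [totalDegree_zero]; exact Nat.zero_le _
    | right j =>
      rw [Fin.addCases_right, Fin.addCases_right]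
      split_ifs
      · exact hP _
      · rw [totalDegree_zero]; exact Nat.zero_le _
  calc ∑ i, (Polynomial.sylvester P Q m k (π i) i).totalDegree
      ≤ ∑ i : Fin (m + k), Fin.addCases (fun _ => B) (fun _ => A) i :=
        Finset.sum_le_sum fun i _ => hentry _ _
    _ = k * A + m * B := by
        rw [Fin.sum_univ_add]
        simp only [Fin.addCases_left, Fin.addCases_right, Finset.sum_const, Finset.card_univ,
          Fintype.card_fin, smul_eq_mul]
        ring

/-- An irreducible polynomial of positive degree is primitive. [folklore] -/
private theorem isPrimitive_of_irreducible {R : Type*} [CommRing R] [IsDomain R]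
    {P : Polynomial R} (hP : Irreducible P) (hdeg : 0 < P.natDegree) : P.IsPrimitive := by
  rw [Polynomial.isPrimitive_iff_isUnit_of_C_dvd]
  intro r hr
  obtain ⟨s, hs⟩ := hr
  rcases hP.isUnit_or_isUnit hs with hu | hu
  · exact Polynomial.isUnit_C.1 hu
  · exfalso
    rw [Polynomial.isUnit_iff] at hu
    obtain ⟨c, -, rfl⟩ := hu
    rw [← Polynomial.C_mul] at hs
    rw [hs, Polynomial.natDegree_C] at hdeg
    exact lt_irrefl 0 hdeg

/-- **The resultant of the sheared factor and cofactor is nonzero**: if `g` is irreducible of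
positive degree and `g ∤ h`, then `Res_Y(g(b + aY), h(b + aY)) ≠ 0` in `K[a, b]` (Gauss's lemma
over the UFD `K[a, b]`: the sheared `g` is irreducible and primitive, hence irreducible over
`K(a, b)`, where it does not divide the sheared `h`).
[cite: Kaltofen1986, §2 (Step R: with high probability the substituted factors stay coprime)] -/
theorem resultant_symShear_ne_zero {g h : MvPolynomial (Fin n) K} (hg : Irreducible g)
    (hgh : ¬ g ∣ h) : Polynomial.resultant (symShear K n g) (symShear K n h) ≠ 0 := by
  classical
  set R := MvPolynomial (Fin n ⊕ Fin n) K
  set 𝒢 := symShear K n g with h𝒢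
  set ℋ := symShear K n h with hℋ
  set Kf := FractionRing (MvPolynomial (Fin n ⊕ Fin n) K)
  set ι : MvPolynomial (Fin n ⊕ Fin n) K →+* Kf := algebraMap _ Kf with hι
  have hιinj : Function.Injective ι := IsFractionRing.injective _ _
  have hg0 : g ≠ 0 := hg.ne_zero
  have hδpos : 0 < g.totalDegree := by
    by_contra h0
    push Not at h0
    have h0' : g.totalDegree = 0 := Nat.le_zero.1 h0
    rw [totalDegree_eq_zero_iff_eq_C] at h0'
    refine hg.not_isUnit ?_
    rw [h0']
    refine (isUnit_iff_ne_zero.2 ?_).map C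
    intro hc
    exact hg0 (by rw [h0', hc, C_0])
  have hdeg𝒢 : 𝒢.natDegree = g.totalDegree := (natDegree_symShear g hg0).1
  have hirr : Irreducible 𝒢 := irreducible_symShear hg
  have hprim : 𝒢.IsPrimitive := isPrimitive_of_irreducible hirr (by rw [hdeg𝒢]; exact hδpos)
  have hirrK : Irreducible (𝒢.map ι) :=
    (Polynomial.IsPrimitive.irreducible_iff_irreducible_map_fraction_map (K := Kf) hprim).1 hirr
  have hndvd : ¬ 𝒢.map ι ∣ ℋ.map ι := by
    intro hd
    have := Polynomial.IsPrimitive.dvd_of_fraction_map_dvd_fraction_map (K := Kf) hprim hd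
    exact hgh (dvd_of_symShear_dvd this)
  have hcop : IsCoprime (𝒢.map ι) (ℋ.map ι) := hirrK.coprime_iff_not_dvd.2 hndvd
  have hres : Polynomial.resultant (𝒢.map ι) (ℋ.map ι) ≠ 0 := Polynomial.resultant_ne_zero _ _ hcop
  intro hzero
  apply hres
  have h1 := Polynomial.resultant_map_map 𝒢 ℋ 𝒢.natDegree ℋ.natDegree ι
  rw [hzero, map_zero] at h1
  rwa [Polynomial.natDegree_map_eq_of_injective hιinj, Polynomial.natDegree_map_eq_of_injective hιinj]

end SymbolicShear

/-! ### The genericity polynomial and its specialisations -/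

section GoodPoint

variable {K : Type*} [Field K] {n : ℕ}

/-- **The genericity polynomial** `𝔊 = g_δ(a) · h_η(a) · g(b) · Res_Y(g(b + aY), h(b + aY))`
(`δ = deg g`, `η = deg h`): its non-vanishing at `(a₀, b₀)` guarantees that the shear `a₀`
makes `g, h` monic in `y`, that `g(b₀) ≠ 0`, and that the fibres `g(b₀ + a₀Y)`, `h(b₀ + a₀Y)`
are coprime. PLUMBING DEFINITION with body.
[cite: Kaltofen1986, §2 (Step R; Thm. 2.1: the algorithm "requires polynomially many randomly selected field elements")] -/
def genericityPoly (g h : MvPolynomial (Fin n) K) : MvPolynomial (Fin n ⊕ Fin n) K :=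
  rename Sum.inl (homogeneousComponent g.totalDegree g) *
    rename Sum.inl (homogeneousComponent h.totalDegree h) * rename Sum.inr g *
      Polynomial.resultant (symShear K n g) (symShear K n h)

/-- **`𝔊 ≠ 0`.** [cite: Kaltofen1986, §2 (Step R) and Thm. 2.1] -/
theorem genericityPoly_ne_zero {g h : MvPolynomial (Fin n) K} (hg : Irreducible g) (hh : h ≠ 0)
    (hgh : ¬ g ∣ h) : genericityPoly g h ≠ 0 := by
  have hg0 : g ≠ 0 := hg.ne_zero
  refine mul_ne_zero (mul_ne_zero (mul_ne_zero ?_ ?_) ?_) (resultant_symShear_ne_zero hg hgh)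
  · exact (map_ne_zero_iff _ (rename_injective _ Sum.inl_injective)).2
      (homogeneousComponent_totalDegree_ne_zero hg0)
  · exact (map_ne_zero_iff _ (rename_injective _ Sum.inl_injective)).2
      (homogeneousComponent_totalDegree_ne_zero hh)
  · exact (map_ne_zero_iff _ (rename_injective _ Sum.inr_injective)).2 hg0

/-- **Degree of `𝔊`**: `≤ 2δ + η + 2δη`. [folklore] -/
private theorem totalDegree_genericityPoly_le (g h : MvPolynomial (Fin n) K) :
    (genericityPoly g h).totalDegree ≤
      2 * g.totalDegree + h.totalDegree + 2 * g.totalDegree * h.totalDegree := by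
  have h1 : (rename (Sum.inl : Fin n → Fin n ⊕ Fin n)
      (homogeneousComponent g.totalDegree g)).totalDegree ≤ g.totalDegree :=
    (totalDegree_rename_le _ _).trans (homogeneousComponent_isHomogeneous _ _).totalDegree_le
  have h2 : (rename (Sum.inl : Fin n → Fin n ⊕ Fin n)
      (homogeneousComponent h.totalDegree h)).totalDegree ≤ h.totalDegree :=
    (totalDegree_rename_le _ _).trans (homogeneousComponent_isHomogeneous _ _).totalDegree_le
  have h3 : (rename (Sum.inr : Fin n → Fin n ⊕ Fin n) g).totalDegree ≤ g.totalDegree :=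
    totalDegree_rename_le _ _
  have h4 : (Polynomial.resultant (symShear K n g) (symShear K n h)).totalDegree ≤
      2 * g.totalDegree * h.totalDegree := by
    refine (totalDegree_resultant_le (totalDegree_coeff_symShear_le g)
      (totalDegree_coeff_symShear_le h) _ _).trans ?_
    calc (symShear K n h).natDegree * g.totalDegree + (symShear K n g).natDegree * h.totalDegree
        ≤ h.totalDegree * g.totalDegree + g.totalDegree * h.totalDegree := by
          gcongr
          · exact natDegree_symShear_le h
          · exact natDegree_symShear_le g
      _ = 2 * g.totalDegree * h.totalDegree := by ring
  rw [genericityPoly]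
  refine (totalDegree_mul _ _).trans ?_
  refine (add_le_add ((totalDegree_mul _ _).trans (add_le_add ((totalDegree_mul _ _).trans
    (add_le_add h1 h2)) h3)) h4).trans ?_
  omega

variable {L : Type*} [Field L] [Algebra K L]

/-- **Specialisation of `𝔊` at a good point**: non-vanishing of the two leading forms and of
`g(b₀)`. [folklore] -/
private theorem specialise_ne_zero {g h : MvPolynomial (Fin n) K} {v : Fin n ⊕ Fin n → L}
    (hv : aeval v (genericityPoly g h) ≠ 0) :
    aeval (v ∘ Sum.inl) (homogeneousComponent g.totalDegree g) ≠ 0 ∧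
      aeval (v ∘ Sum.inl) (homogeneousComponent h.totalDegree h) ≠ 0 ∧
        aeval (v ∘ Sum.inr) g ≠ 0 ∧
          aeval v (Polynomial.resultant (symShear K n g) (symShear K n h)) ≠ 0 := by
  rw [genericityPoly, map_mul, map_mul, map_mul, aeval_rename, aeval_rename, aeval_rename] at hv
  exact ⟨left_ne_zero_of_mul (left_ne_zero_of_mul (left_ne_zero_of_mul hv)),
    right_ne_zero_of_mul (left_ne_zero_of_mul (left_ne_zero_of_mul hv)),
    right_ne_zero_of_mul (left_ne_zero_of_mul hv), right_ne_zero_of_mul hv⟩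

/-- **At a good point the fibres are coprime**: `Y ↦ g(b₀ + a₀Y)` and `Y ↦ h(b₀ + a₀Y)` are
coprime in `L[Y]` (the resultant specialises, `Polynomial.resultant_map_map`, and a nonzero
resultant over a field means coprime, `Polynomial.resultant_eq_zero_iff`).
[cite: Kaltofen1986, §2 (Step R: "Check whether GCD(g_{i,0}, g_{j,0}) ∼ 1")] -/
theorem isCoprime_map_symShear {g h : MvPolynomial (Fin n) K} (hg : g ≠ 0)
    {v : Fin n ⊕ Fin n → L} (hv : aeval v (genericityPoly g h) ≠ 0) :
    IsCoprime ((symShear K n g).map (aeval v : MvPolynomial (Fin n ⊕ Fin n) K →ₐ[K] L).toRingHom)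
      ((symShear K n h).map (aeval v : MvPolynomial (Fin n ⊕ Fin n) K →ₐ[K] L).toRingHom) := by
  obtain ⟨h1, -, -, h4⟩ := specialise_ne_zero hv
  set φ := (aeval v : MvPolynomial (Fin n ⊕ Fin n) K →ₐ[K] L).toRingHom with hφ
  have hlc : φ (symShear K n g).leadingCoeff ≠ 0 := by
    rw [(natDegree_symShear g hg).2, hφ, AlgHom.toRingHom_eq_coe, AlgHom.coe_toRingHom, aeval_rename]
    exact h1
  have hdeg : ((symShear K n g).map φ).natDegree = (symShear K n g).natDegree :=
    Polynomial.natDegree_map_of_leadingCoeff_ne_zero φ hlc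
  have hne : (symShear K n g).map φ ≠ 0 := by
    intro h0
    apply hlc
    rw [← Polynomial.leadingCoeff_map_of_leadingCoeff_ne_zero φ hlc, h0, Polynomial.leadingCoeff_zero]
  have hres : Polynomial.resultant ((symShear K n g).map φ) ((symShear K n h).map φ)
      (symShear K n g).natDegree (symShear K n h).natDegree ≠ 0 := by
    rw [Polynomial.resultant_map_map]
    rw [hφ, AlgHom.toRingHom_eq_coe, AlgHom.coe_toRingHom]
    exact h4
  -- pass to the true degrees of the specialisations
  by_cases hdegH : ((symShear K n h).map φ).natDegree = (symShear K n h).natDegree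
  · rw [← hdeg, ← hdegH] at hres
    have := (not_congr (Polynomial.resultant_eq_zero_iff (f := (symShear K n g).map φ)
      (g := (symShear K n h).map φ))).1 hres
    push Not at this
    exact this (Or.inl hne)
  · -- the degree of the specialised `h` dropped: pad with `resultant_add_right_deg`-free argument:
    -- use the Bézout identity from the adjugate at the formal degrees
    have hk : (symShear K n h).natDegree ≠ 0 := by
      intro h0
      apply hdegH
      rw [h0]
      have := Polynomial.natDegree_map_le (f := φ) (p := symShear K n h)
      omega
    obtain ⟨A, B, -, -, hAB⟩ := Polynomial.exists_mul_add_mul_eq_C_resultant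
      ((symShear K n g).map φ) ((symShear K n h).map φ) (m := (symShear K n g).natDegree)
      (n := (symShear K n h).natDegree) (by rw [hdeg]) Polynomial.natDegree_map_le (Or.inr hk)
    set r := Polynomial.resultant ((symShear K n g).map φ) ((symShear K n h).map φ)
      (symShear K n g).natDegree (symShear K n h).natDegree with hr
    refine ⟨Polynomial.C r⁻¹ * A, Polynomial.C r⁻¹ * B, ?_⟩
    calc Polynomial.C r⁻¹ * A * (symShear K n g).map φ + Polynomial.C r⁻¹ * B * (symShear K n h).map φ
        = Polynomial.C r⁻¹ * ((symShear K n g).map φ * A + (symShear K n h).map φ * B) := by ring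
      _ = 1 := by rw [hAB, ← Polynomial.C_mul, inv_mul_cancel₀ hres, Polynomial.C_1]

/-- **A good point exists in every sufficiently large finite extension**: a nonzero polynomial
of total degree `< |L|` does not vanish identically on `L^σ`
(`MvPolynomial.eq_zero_of_eval_eq_zero`). [folklore] -/
private theorem exists_aeval_ne_zero {σ : Type} [Fintype σ] {𝕃 : Type} [Field 𝕃] [Algebra K 𝕃] [Fintype 𝕃]
    (P : MvPolynomial σ K) (hP : P ≠ 0) (hdeg : P.totalDegree < Fintype.card 𝕃) :
    ∃ v : σ → 𝕃, aeval v P ≠ 0 := by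
  classical
  by_contra hall
  push Not at hall
  have hinj : Function.Injective (algebraMap K 𝕃) := (algebraMap K 𝕃).injective
  have hPL : MvPolynomial.map (algebraMap K 𝕃) P ≠ 0 :=
    fun h0 => hP (map_injective _ hinj (by rw [h0, map_zero]))
  refine hPL (MvPolynomial.eq_zero_of_eval_eq_zero σ 𝕃 _ (fun v => ?_) ?_)
  · rw [eval_map, ← aeval_def]
    exact hall v
  · rw [mem_restrictDegree]
    intro s hs i
    have h1 : s i ≤ (MvPolynomial.map (algebraMap K 𝕃) P).totalDegree :=
      (Finsupp.le_degree i s).trans (by have := le_totalDegree hs; rwa [Finsupp.degree_apply])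
    have h2 : (MvPolynomial.map (algebraMap K 𝕃) P).totalDegree = P.totalDegree := by
      rw [totalDegree, totalDegree, support_map_of_injective _ hinj]
    omega

end GoodPoint

/-! ### The shear-and-translate substitution over the extension field -/

section Substitution

variable {L : Type*} [Field L] {n : ℕ}

/-- **The substitution `xᵢ ↦ xᵢ + b₀ᵢ + a₀ᵢ y`** (shear by `a₀` followed by translation by
`b₀`; `y = X none`). PLUMBING DEFINITION with body. [cite: Kaltofen1986, §2 (Step R, the substitution into f)] -/
def shearTranslate (a₀ b₀ : Fin n → L) : MvPolynomial (Fin n) L →ₐ[L] MvPolynomial (Option (Fin n)) L :=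
  aeval fun i : Fin n => X (some i) + C (b₀ i) + C (a₀ i) * X none

/-- `shearTranslate = translate ∘ shear`. [folklore] -/
private theorem shearTranslate_eq (a₀ b₀ : Fin n → L) (φ : MvPolynomial (Fin n) L) :
    shearTranslate a₀ b₀ φ = aeval (fun o : Option (Fin n) => o.elim (X none)
      fun i => X (some i) + C (b₀ i)) (aeval (fun i : Fin n => X (some i) + C (a₀ i) * X none) φ) := by
  have hfun : (fun i : Fin n => (X (some i) + C (b₀ i) + C (a₀ i) * X none :
      MvPolynomial (Option (Fin n)) L)) = fun i => aeval (fun o : Option (Fin n) => o.elim (X none)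
        fun i => X (some i) + C (b₀ i)) (X (some i) + C (a₀ i) * X none) := by
    funext i
    simp only [map_add, map_mul, aeval_X, Option.elim_some, aeval_C, algebraMap_eq, Option.elim_none]
  rw [shearTranslate, hfun, ← MvPolynomial.comp_aeval, AlgHom.comp_apply]

/-- Translation acts coefficientwise on `L[x][Y]` (copy of the tree's private
`optionEquivLeft_aeval_translate`, `RootLifting.lean`). [folklore] -/
private theorem optionEquivLeft_translate (b₀ : Fin n → L) (G : MvPolynomial (Option (Fin n)) L) :
    optionEquivLeft L (Fin n)
        (aeval (fun o : Option (Fin n) => o.elim (X none) fun i => X (some i) + C (b₀ i)) G) =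
      Polynomial.mapAlgHom (aeval fun i : Fin n => X i + C (b₀ i)) (optionEquivLeft L (Fin n) G) := by
  have key : (optionEquivLeft L (Fin n) : MvPolynomial (Option (Fin n)) L →ₐ[L]
      Polynomial (MvPolynomial (Fin n) L)).comp
        (aeval fun o : Option (Fin n) => o.elim (X none) fun i => X (some i) + C (b₀ i)) =
      (Polynomial.mapAlgHom (aeval fun i : Fin n => X i + C (b₀ i))).comp
        (optionEquivLeft L (Fin n) : MvPolynomial (Option (Fin n)) L →ₐ[L]
          Polynomial (MvPolynomial (Fin n) L)) := by
    refine MvPolynomial.algHom_ext fun o => ?_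
    rcases o with _ | b
    · simp [Polynomial.coe_mapAlgHom]
    · simp [Polynomial.coe_mapAlgHom]
  exact AlgHom.congr_fun key G

/-- `map` commutes with homogeneous components. [folklore] -/
private theorem homogeneousComponent_map {K : Type*} [Field K] (ι : K →+* L) (k : ℕ)
    (φ : MvPolynomial (Fin n) K) :
    homogeneousComponent k (MvPolynomial.map ι φ) = MvPolynomial.map ι (homogeneousComponent k φ) := by
  ext m
  rw [coeff_homogeneousComponent, coeff_map, coeff_map, coeff_homogeneousComponent]
  split_ifs <;> simp

/-- `map` along an injective hom preserves the total degree. [folklore] -/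
private theorem totalDegree_map_of_injective {K : Type*} [Field K] {ι : K →+* L}
    (hι : Function.Injective ι) (φ : MvPolynomial (Fin n) K) :
    (MvPolynomial.map ι φ).totalDegree = φ.totalDegree := by
  rw [totalDegree, totalDegree, support_map_of_injective _ hι]

/-- **Degree and leading coefficient after the substitution**: for `φ₀ ∈ K[x]` with
`φ₀_{deg}(a₀) ≠ 0`, the image of `φ = φ₀^L` under `xᵢ ↦ xᵢ + b₀ᵢ + a₀ᵢ y` has `y`-degree
`deg φ₀` and the CONSTANT leading coefficient `φ₀_{deg}(a₀)`.
[cite: DuttaSaxenaSinhababu2018, Lemma 28 (transform to monic)] -/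
theorem natDegree_shearTranslate {K : Type*} [Field K] [Algebra K L] (a₀ b₀ : Fin n → L)
    (φ₀ : MvPolynomial (Fin n) K) (ha : aeval a₀ (homogeneousComponent φ₀.totalDegree φ₀) ≠ 0) :
    (optionEquivLeft L (Fin n) (shearTranslate a₀ b₀ (MvPolynomial.map (algebraMap K L) φ₀))).natDegree
        = φ₀.totalDegree ∧
      (optionEquivLeft L (Fin n) (shearTranslate a₀ b₀
        (MvPolynomial.map (algebraMap K L) φ₀))).leadingCoeff =
          C (aeval a₀ (homogeneousComponent φ₀.totalDegree φ₀)) := by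
  set φ := MvPolynomial.map (algebraMap K L) φ₀ with hφ
  have hinj : Function.Injective (algebraMap K L) := (algebraMap K L).injective
  have htd : φ.totalDegree = φ₀.totalDegree := totalDegree_map_of_injective hinj φ₀
  have hev : eval a₀ (homogeneousComponent φ.totalDegree φ) =
      aeval a₀ (homogeneousComponent φ₀.totalDegree φ₀) := by
    rw [htd, hφ, homogeneousComponent_map, eval_map, ← aeval_def]
  have ha' : eval a₀ (homogeneousComponent φ.totalDegree φ) ≠ 0 := by rw [hev]; exact ha
  obtain ⟨hdeg, hlc⟩ := KaltofenFactor.natDegree_leadingCoeff_optionEquivLeft_shear a₀ φ ha'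
  rw [shearTranslate_eq, optionEquivLeft_translate, Polynomial.coe_mapAlgHom]
  set τ : MvPolynomial (Fin n) L →ₐ[L] MvPolynomial (Fin n) L := aeval fun i : Fin n => X i + C (b₀ i)
  have hτ : (τ : MvPolynomial (Fin n) L →+* MvPolynomial (Fin n) L) (optionEquivLeft L (Fin n)
      (aeval (fun i : Fin n => X (some i) + C (a₀ i) * X none) φ)).leadingCoeff ≠ 0 := by
    rw [hlc, RingHom.coe_coe, aeval_C, algebraMap_eq]
    exact fun h0 => ha' (C_injective _ _ (by rw [h0, C_0]))
  refine ⟨?_, ?_⟩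
  · rw [Polynomial.natDegree_map_of_leadingCoeff_ne_zero _ hτ, hdeg, htd]
  · rw [Polynomial.leadingCoeff_map_of_leadingCoeff_ne_zero _ hτ, hlc, RingHom.coe_coe, aeval_C,
      algebraMap_eq, hev]

/-- **The fibre over `x = 0` of the substituted polynomial is the specialised symbolic shear.**
[folklore] -/
private theorem map_constantCoeff_shearTranslate {K : Type*} [Field K] [Algebra K L]
    (v : Fin n ⊕ Fin n → L) (φ₀ : MvPolynomial (Fin n) K) :
    (optionEquivLeft L (Fin n) (shearTranslate (v ∘ Sum.inl) (v ∘ Sum.inr)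
      (MvPolynomial.map (algebraMap K L) φ₀))).map (constantCoeff : MvPolynomial (Fin n) L →+* L) =
        (symShear K n φ₀).map (aeval v : MvPolynomial (Fin n ⊕ Fin n) K →ₐ[K] L).toRingHom := by
  have hX : ∀ i : Fin n, (optionEquivLeft L (Fin n) (shearTranslate (v ∘ Sum.inl) (v ∘ Sum.inr)
      (MvPolynomial.map (algebraMap K L) (X i)))).map (constantCoeff : MvPolynomial (Fin n) L →+* L) =
        (symShear K n (X i)).map (aeval v : MvPolynomial (Fin n ⊕ Fin n) K →ₐ[K] L).toRingHom := by
    intro i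
    rw [map_X, shearTranslate, aeval_X, symShear_X]
    simp only [map_add, map_mul, optionEquivLeft_X_some, optionEquivLeft_C, optionEquivLeft_X_none,
      Polynomial.map_add, Polynomial.map_mul, Polynomial.map_C, Polynomial.map_X, constantCoeff_X,
      constantCoeff_C, map_zero, zero_add, Function.comp_apply, AlgHom.toRingHom_eq_coe,
      AlgHom.coe_toRingHom, aeval_X]
    ring
  induction φ₀ using MvPolynomial.induction_on with
  | C c =>
    rw [map_C, shearTranslate, aeval_C, algebraMap_eq, optionEquivLeft_C, Polynomial.map_C,
      constantCoeff_C, symShear, aeval_C, Polynomial.algebraMap_apply, algebraMap_eq, Polynomial.map_C,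
      AlgHom.toRingHom_eq_coe, AlgHom.coe_toRingHom, aeval_C]
  | add p q hp hq =>
    simp only [map_add, Polynomial.map_add, hp, hq]
  | mul_X p i hp =>
    simp only [map_mul, Polynomial.map_mul]
    rw [hp, hX i]

/-- The constant term after the substitution is the value at `b₀`. [folklore] -/
private theorem constantCoeff_shearTranslate (a₀ b₀ : Fin n → L) (φ : MvPolynomial (Fin n) L) :
    constantCoeff (shearTranslate a₀ b₀ φ) = eval b₀ φ := by
  have key : (constantCoeff : MvPolynomial (Option (Fin n)) L →+* L).comp
      (shearTranslate a₀ b₀ : MvPolynomial (Fin n) L →ₐ[L] MvPolynomial (Option (Fin n)) L).toRingHom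
        = eval b₀ := by
    refine MvPolynomial.ringHom_ext (fun c => ?_) (fun i => ?_)
    · simp [shearTranslate]
    · simp [shearTranslate]
  exact RingHom.congr_fun key φ

/-- Undoing the substitution: `y ↦ 0`, `xᵢ ↦ xᵢ − b₀ᵢ`. [folklore] -/
private theorem aeval_undo_shearTranslate (a₀ b₀ : Fin n → L) (φ : MvPolynomial (Fin n) L) :
    aeval (fun o : Option (Fin n) => o.elim 0 fun i => X i - C (b₀ i)) (shearTranslate a₀ b₀ φ) = φ := by
  rw [shearTranslate, ← AlgHom.comp_apply, MvPolynomial.comp_aeval]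
  have : (fun i : Fin n => aeval (fun o : Option (Fin n) => o.elim (0 : MvPolynomial (Fin n) L)
      fun i => X i - C (b₀ i)) (X (some i) + C (b₀ i) + C (a₀ i) * X none)) = X := by
    funext i
    simp only [map_add, map_mul, aeval_X, Option.elim_some, aeval_C, algebraMap_eq, Option.elim_none,
      mul_zero, add_zero, sub_add_cancel]
  rw [this, aeval_X_left_apply]

/-- The substitution does not raise the total degree (copy of the tree's private
`totalDegree_aeval_le_linear_aux`). [folklore] -/
private theorem totalDegree_aeval_le_linear {β γ : Type*} {t : β → MvPolynomial γ L}
    (ht : ∀ b, (t b).totalDegree ≤ 1) (φ : MvPolynomial β L) :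
    (aeval t φ).totalDegree ≤ φ.totalDegree := by
  classical
  conv_lhs => rw [φ.as_sum]
  rw [map_sum]
  refine totalDegree_finsetSum_le fun m hm => ?_
  rw [aeval_monomial, algebraMap_eq]
  refine (totalDegree_mul _ _).trans ?_
  rw [totalDegree_C, zero_add]
  simp only [Finsupp.prod]
  refine (totalDegree_finsetProd _ _).trans ?_
  calc ∑ i ∈ m.support, (t i ^ m i).totalDegree ≤ ∑ i ∈ m.support, m i := by
        refine Finset.sum_le_sum fun i _ => (totalDegree_pow _ _).trans ?_
        calc m i * (t i).totalDegree ≤ m i * 1 := Nat.mul_le_mul_left _ (ht i)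
          _ = m i := mul_one _
    _ ≤ φ.totalDegree := by
        have := le_totalDegree hm
        simpa only [Finsupp.sum] using this

/-- The substitution does not raise the total degree. [folklore] -/
private theorem totalDegree_shearTranslate_le (a₀ b₀ : Fin n → L) (φ : MvPolynomial (Fin n) L) :
    (shearTranslate a₀ b₀ φ).totalDegree ≤ φ.totalDegree := by
  refine totalDegree_aeval_le_linear (fun i => ?_) φ
  refine (totalDegree_add _ _).trans (max_le ((totalDegree_add _ _).trans (max_le ?_ ?_)) ?_)
  · exact (totalDegree_X _).le
  · rw [totalDegree_C]; exact Nat.zero_le _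
  · refine (totalDegree_mul _ _).trans ?_
    rw [totalDegree_C, zero_add]
    exact (totalDegree_X _).le

/-- Cost of the substitution: `L(φ(x + b₀ + a₀ y)) ≤ L(φ) + 3n`. [folklore] -/
private theorem complexity_shearTranslate_le (a₀ b₀ : Fin n → L) (φ : MvPolynomial (Fin n) L) :
    complexity (shearTranslate a₀ b₀ φ) ≤ complexity φ + 3 * n := by
  rw [shearTranslate]
  refine (complexity_aeval_le _ _).trans ?_
  have h : ∀ i : Fin n, complexity (X (some i) + C (b₀ i) + C (a₀ i) * X none :
      MvPolynomial (Option (Fin n)) L) ≤ 3 := by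
    intro i
    calc _ ≤ complexity (X (some i) + C (b₀ i) : MvPolynomial (Option (Fin n)) L) +
          complexity (C (a₀ i) * X none : MvPolynomial (Option (Fin n)) L) + 1 :=
          complexity_add_le_holds _ _
      _ ≤ (0 + 0 + 1) + (0 + 0 + 1) + 1 := by
          gcongr
          · calc _ ≤ complexity (X (some i) : MvPolynomial (Option (Fin n)) L) +
                complexity (C (b₀ i) : MvPolynomial (Option (Fin n)) L) + 1 :=
                complexity_add_le_holds _ _
              _ = 0 + 0 + 1 := by rw [complexity_X_holds, complexity_C_holds]
          · calc _ ≤ complexity (C (a₀ i) : MvPolynomial (Option (Fin n)) L) +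
                complexity (X none : MvPolynomial (Option (Fin n)) L) + 1 :=
                complexity_mul_le_holds _ _
              _ = 0 + 0 + 1 := by rw [complexity_X_holds, complexity_C_holds]
      _ = 3 := by ring
  calc complexity φ + ∑ i : Fin n, complexity (X (some i) + C (b₀ i) + C (a₀ i) * X none :
        MvPolynomial (Option (Fin n)) L) ≤ complexity φ + ∑ _i : Fin n, 3 := by
        gcongr with i _; exact h i
    _ = complexity φ + 3 * n := by rw [sum_const, card_univ, Fintype.card_fin, smul_eq_mul]; ring

/-- Cost of undoing the substitution. [folklore] -/
private theorem complexity_undo_le (b₀ : Fin n → L) (ψ : MvPolynomial (Option (Fin n)) L) :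
    complexity (aeval (fun o : Option (Fin n) => o.elim 0 fun i => X i - C (b₀ i)) ψ) ≤
      complexity ψ + n := by
  refine (complexity_aeval_le _ _).trans ?_
  rw [Fintype.sum_option]
  simp only [Option.elim_none, Option.elim_some]
  have h0 : complexity (0 : MvPolynomial (Fin n) L) = 0 := by rw [← C_0, complexity_C_holds]
  have h1 : ∀ i : Fin n, complexity (X i - C (b₀ i) : MvPolynomial (Fin n) L) ≤ 1 := by
    intro i
    rw [sub_eq_add_neg, ← map_neg C]
    calc _ ≤ complexity (X i : MvPolynomial (Fin n) L) +
          complexity (C (-b₀ i) : MvPolynomial (Fin n) L) + 1 := complexity_add_le_holds _ _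
      _ = 1 := by rw [complexity_X_holds, complexity_C_holds]
  rw [h0, zero_add]
  calc complexity ψ + ∑ i : Fin n, complexity (X i - C (b₀ i) : MvPolynomial (Fin n) L)
      ≤ complexity ψ + ∑ _i : Fin n, 1 := by gcongr with i _; exact h1 i
    _ = complexity ψ + n := by rw [sum_const, card_univ, Fintype.card_fin, smul_eq_mul, mul_one]

end Substitution

/-! ### Assembly over the extension field -/

section Assembly

variable {K L : Type*} [Field K] [Field L] [Algebra K L] {n : ℕ}

/-- An irreducible polynomial has positive total degree. [folklore] -/
private theorem totalDegree_pos_of_irreducible {g : MvPolynomial (Fin n) K} (hg : Irreducible g) :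
    0 < g.totalDegree := by
  by_contra h0
  push Not at h0
  have h0' : g.totalDegree = 0 := Nat.le_zero.1 h0
  rw [totalDegree_eq_zero_iff_eq_C] at h0'
  refine hg.not_isUnit ?_
  rw [h0']
  refine (isUnit_iff_ne_zero.2 ?_).map C
  intro hc
  exact hg.ne_zero (by rw [h0', hc, C_0])

/-- Total degree of a power in a domain. [folklore] -/
private theorem totalDegree_pow_of_ne_zero {g : MvPolynomial (Fin n) K} (hg : g ≠ 0) (k : ℕ) :
    (g ^ k).totalDegree = k * g.totalDegree := by
  induction k with
  | zero => rw [pow_zero, totalDegree_one, zero_mul]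
  | succ k ih =>
    rw [pow_succ, totalDegree_mul_of_isDomain (pow_ne_zero _ hg) hg, ih]
    ring

/-- `L(x_i^e) ≤ e`. [folklore] -/
private theorem complexity_X_pow_le {σ : Type*} (i : σ) (e : ℕ) :
    complexity (X i ^ e : MvPolynomial σ L) ≤ e := by
  classical
  have h := complexity_finset_prod_le (Finset.range e) (fun _ => (X i : MvPolynomial σ L))
  rw [Finset.prod_const, Finset.card_range] at h
  refine h.trans ?_
  rw [Finset.sum_eq_zero fun j _ => complexity_X_holds (k := L) i, zero_add]

/-- `optionEquivLeft` sends `rename some u` to the constant `C u`. [folklore] -/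
private theorem optionEquivLeft_rename_some {β : Type*} (u : MvPolynomial β L) :
    optionEquivLeft L β (rename some u) = Polynomial.C u := by
  induction u using MvPolynomial.induction_on with
  | C c => rw [rename_C, optionEquivLeft_C]
  | add p q hp hq => rw [map_add, map_add, hp, hq, map_add]
  | mul_X p i hp => rw [map_mul, map_mul, hp, rename_X, optionEquivLeft_X_some, map_mul]

/-- **The explicit polynomial bound** of the positive-characteristic factor theorem over the
extension field: `henselBound n s d` bounds `L_𝕃(g^{p^e})` for `s = L(f)`, `d = deg f`, `n`
variables. PLUMBING DEFINITION with body. [folklore] -/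
def henselBound (n s d : ℕ) : ℕ :=
  (d + 3) ^ 2 * (1 * ((d + 1) * (((d + 2) ^ 2 * (d * (2 * d * d * (d * ((s + 3 * n + 1) + 5) + 1) +
    d * (d + 1) + 2) + 2 * d + 2) + (d + 1)) + d + 2 + 2) + 2) + 1 + 1) + (d + 1 + 1) + n + 2

/-- **Kaltofen's theorem in characteristic `p`, over the extension field `𝕃 ⊇ K` containing a
good point and enough nodes** (Kaltofen 1986 §2 with the replacement `g̃ ↦ g̃^{p^ê}`): if
`f = g^{qj} h` in `K[x_1, …, x_n]` with `g` irreducible, `h ≠ 0`, `q ≥ 1`, `j ≠ 0` in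
`𝕃`, the genericity polynomial does not vanish at `v ∈ 𝕃^{2n}`, and `𝕃` has `deg f` distinct
nodes, then `L_𝕃(g^q) ≤ henselBound n L(f) (deg f)`.
[cite: Kaltofen1986, §2 (Algorithm Factorization, Steps R, H, L; p. 334 positive characteristic) and Thm. 2.1] -/
theorem complexity_map_pow_le (f g h : MvPolynomial (Fin n) K) (q j : ℕ) (hq : 1 ≤ q)
    (hj : (j : L) ≠ 0) (hf : f = g ^ (q * j) * h) (hg : Irreducible g) (hh : h ≠ 0)
    (v : Fin n ⊕ Fin n → L) (hv : aeval v (genericityPoly g h) ≠ 0)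
    {d : ℕ} (hfd : f.totalDegree = d) (t : Fin d → L) (ht : Function.Injective t) :
    complexity (MvPolynomial.map (algebraMap K L) (g ^ q)) ≤ henselBound n (complexity f) d := by
  classical
  -- 0. notation and degrees
  have hj0 : j ≠ 0 := by rintro rfl; exact hj Nat.cast_zero
  have hj1 : 1 ≤ j := Nat.one_le_iff_ne_zero.2 hj0
  have hg0 : g ≠ 0 := hg.ne_zero
  have hδ : 0 < g.totalDegree := totalDegree_pos_of_irreducible hg
  set N := q * j with hN
  have hN1 : 1 ≤ N := Nat.one_le_iff_ne_zero.2 (mul_ne_zero (by omega) hj0)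
  set δ := g.totalDegree with hδdef
  set η := h.totalDegree with hηdef
  have hddef : d = f.totalDegree := hfd.symm
  have hgN0 : g ^ N ≠ 0 := pow_ne_zero _ hg0
  have hd : d = N * δ + η := by
    rw [hddef, hf, totalDegree_mul_of_isDomain hgN0 hh, totalDegree_pow_of_ne_zero hg0]
  have hjd : j ≤ d := by
    rw [hd]
    calc j ≤ q * j := Nat.le_mul_of_pos_left j hq
      _ = N * 1 := by rw [hN, mul_one]
      _ ≤ N * δ + η := by have := Nat.mul_le_mul_left N hδ; omega
  have hqδd : q * δ ≤ d := by
    rw [hd]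
    calc q * δ ≤ q * j * δ := Nat.mul_le_mul_right δ (Nat.le_mul_of_pos_right q hj1)
      _ ≤ N * δ + η := by rw [hN]; omega
  have hNδd : N * δ ≤ d := by rw [hd]; omega
  -- 1. the good point
  obtain ⟨hcg, hch, hgb, -⟩ := specialise_ne_zero hv
  have hcopL := isCoprime_map_symShear (L := L) hg0 hv
  set cg := aeval (v ∘ Sum.inl) (homogeneousComponent g.totalDegree g) with hcgdef
  set ch := aeval (v ∘ Sum.inl) (homogeneousComponent h.totalDegree h) with hchdef
  set ι := algebraMap K L with hι
  have hιinj : Function.Injective ι := (algebraMap K L).injective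
  set gL := MvPolynomial.map ι g with hgL
  set hL := MvPolynomial.map ι h with hhL
  set fL := MvPolynomial.map ι f with hfL
  set sT := shearTranslate (v ∘ Sum.inl) (v ∘ Sum.inr) with hsT
  -- 2. the univariate pictures
  set G₁ := optionEquivLeft L (Fin n) (sT gL) with hG₁
  set H₁ := optionEquivLeft L (Fin n) (sT hL) with hH₁
  obtain ⟨hG₁deg, hG₁lc⟩ := natDegree_shearTranslate (v ∘ Sum.inl) (v ∘ Sum.inr) g hcg
  obtain ⟨hH₁deg, hH₁lc⟩ := natDegree_shearTranslate (v ∘ Sum.inl) (v ∘ Sum.inr) h hch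
  rw [← hι, ← hgL, ← hsT, ← hG₁] at hG₁deg hG₁lc
  rw [← hι, ← hhL, ← hsT, ← hH₁] at hH₁deg hH₁lc
  have hF₁ : optionEquivLeft L (Fin n) (sT fL) = G₁ ^ N * H₁ := by
    rw [hfL, hf, map_mul, map_pow, map_mul, map_pow, map_mul, map_pow]
  -- 3. monic normalisations
  have hcg0 : cg ≠ 0 := hcg
  have hch0 : ch ≠ 0 := hch
  set Pm := Polynomial.C (C cg⁻¹) * G₁ with hPm
  set Hm := Polynomial.C (C ch⁻¹) * H₁ with hHm
  have hPmM : Pm.Monic := by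
    refine Polynomial.monic_C_mul_of_mul_leadingCoeff_eq_one ?_
    rw [hG₁lc, ← C_mul, inv_mul_cancel₀ hcg0, C_1]
  have hHmM : Hm.Monic := by
    refine Polynomial.monic_C_mul_of_mul_leadingCoeff_eq_one ?_
    rw [hH₁lc, ← C_mul, inv_mul_cancel₀ hch0, C_1]
  have hPmdeg : Pm.natDegree = δ := by
    rw [hPm, Polynomial.natDegree_C_mul (by rw [Ne, C_eq_zero]; exact inv_ne_zero hcg0), hG₁deg]
  have hHmdeg : Hm.natDegree = η := by
    rw [hHm, Polynomial.natDegree_C_mul (by rw [Ne, C_eq_zero]; exact inv_ne_zero hch0), hH₁deg]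
  set P := Pm ^ N with hP
  have hPM : P.Monic := hPmM.pow N
  have hPdeg : P.natDegree = N * δ := by rw [hP, hPmM.natDegree_pow, hPmdeg]
  have hm : P.natDegree + Hm.natDegree = d := by rw [hPdeg, hHmdeg, hd]
  -- 4. the engine data
  set Geng := C (cg ^ N * ch)⁻¹ * sT fL with hGeng
  have hGengEq : optionEquivLeft L (Fin n) Geng = P * Hm := by
    rw [hGeng, map_mul, optionEquivLeft_C, hF₁, hP, hPm, hHm, mul_inv, ← inv_pow, C_mul, C_pow,
      map_mul, map_pow]
    ring
  have hcopEng : IsCoprime (P.map (constantCoeff : MvPolynomial (Fin n) L →+* L))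
      (Hm.map (constantCoeff : MvPolynomial (Fin n) L →+* L)) := by
    have hPmcc : Pm.map (constantCoeff : MvPolynomial (Fin n) L →+* L) = Polynomial.C cg⁻¹ *
        (symShear K n g).map (aeval v : MvPolynomial (Fin n ⊕ Fin n) K →ₐ[K] L).toRingHom := by
      rw [hPm, Polynomial.map_mul, Polynomial.map_C, constantCoeff_C, hG₁, hsT, hgL, hι,
        map_constantCoeff_shearTranslate]
    have hHmcc : Hm.map (constantCoeff : MvPolynomial (Fin n) L →+* L) = Polynomial.C ch⁻¹ *
        (symShear K n h).map (aeval v : MvPolynomial (Fin n ⊕ Fin n) K →ₐ[K] L).toRingHom := by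
      rw [hHm, Polynomial.map_mul, Polynomial.map_C, constantCoeff_C, hH₁, hsT, hhL, hι,
        map_constantCoeff_shearTranslate]
    rw [hP, Polynomial.map_pow, hPmcc, hHmcc]
    refine IsCoprime.pow_left ?_
    refine (isCoprime_mul_unit_left_left ?_ _ _).2 ((isCoprime_mul_unit_left_right ?_ _ _).2 hcopL)
    · exact Polynomial.isUnit_C.2 (isUnit_iff_ne_zero.2 (inv_ne_zero hcg0))
    · exact Polynomial.isUnit_C.2 (isUnit_iff_ne_zero.2 (inv_ne_zero hch0))
  set Ph := (optionEquivLeft L (Fin n)).symm P with hPh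
  have hPhEq : optionEquivLeft L (Fin n) Ph = Polynomial.C (C 1) * P := by
    rw [hPh, AlgEquiv.apply_symm_apply, C_1, Polynomial.C_1, one_mul]
  have hsymmPm : (optionEquivLeft L (Fin n)).symm Pm = C cg⁻¹ * sT gL := by
    rw [hPm, map_mul, optionEquivLeft_symm_C_C, hG₁, AlgEquiv.symm_apply_apply]
  have hPhExp : Ph = (C cg⁻¹ * sT gL) ^ N := by rw [hPh, hP, map_pow, hsymmPm]
  have hgLdeg : gL.totalDegree = δ := totalDegree_map_of_injective hιinj g
  have hsTgLdeg : (C cg⁻¹ * sT gL).totalDegree ≤ δ := by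
    refine (totalDegree_mul _ _).trans ?_
    rw [totalDegree_C, zero_add, ← hgLdeg]
    exact totalDegree_shearTranslate_le _ _ _
  have hPhdeg : Ph.totalDegree ≤ d := by
    rw [hPhExp]
    refine (totalDegree_pow _ _).trans ?_
    exact (Nat.mul_le_mul_left N hsTgLdeg).trans hNδd
  -- 5. the Hensel engine
  have hEngine := KaltofenHensel.complexity_le_of_coprimeFactors Geng Ph 1 P Hm hPM hHmM hGengEq
    hPhEq hcopEng hm t ht hPhdeg
  have hGengc : complexity Geng ≤ complexity f + 3 * n + 1 := by
    calc complexity Geng ≤ complexity (C (cg ^ N * ch)⁻¹ : MvPolynomial (Option (Fin n)) L) +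
          complexity (sT fL) + 1 := complexity_mul_le_holds _ _
      _ ≤ 0 + (complexity f + 3 * n) + 1 := by
          gcongr
          · exact (complexity_C_holds _).le
          · refine (complexity_shearTranslate_le _ _ _).trans ?_
            exact Nat.add_le_add_right (ArithCircuit.complexity_map_le ι f) _
      _ = complexity f + 3 * n + 1 := by ring
  have hPhc : complexity Ph ≤ (d + 2) ^ 2 * (d * (2 * d * d * (d * ((complexity f + 3 * n + 1) + 5)
      + 1) + d * (d + 1) + 2) + 2 * d + 2) + (d + 1) := by
    refine hEngine.trans ?_
    gcongr
  -- 6. the `j`-th root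
  set W := (optionEquivLeft L (Fin n)).symm (Pm ^ q) with hW
  have hWExp : W = (C cg⁻¹ * sT gL) ^ q := by rw [hW, map_pow, hsymmPm]
  have hPhW : Ph = W ^ j := by rw [hPh, hP, hN, pow_mul, map_pow]
  have hWdeg : W.totalDegree ≤ d := by
    rw [hWExp]
    refine (totalDegree_pow _ _).trans ?_
    exact (Nat.mul_le_mul_left q hsTgLdeg).trans hqδd
  set c := constantCoeff W with hc
  have hcEq : c = (cg⁻¹ * aeval (v ∘ Sum.inr) g) ^ q := by
    rw [hc, hWExp, map_pow, map_mul, constantCoeff_C, hsT, constantCoeff_shearTranslate, hgL, hι,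
      eval_map, ← aeval_def]
  have hc0 : c ≠ 0 := by
    rw [hcEq]
    exact pow_ne_zero _ (mul_ne_zero (inv_ne_zero hcg0) hgb)
  set Groot : MvPolynomial (Option (Option (Fin n))) L := X none ^ j - rename some Ph with hGroot
  set Proot : Polynomial (MvPolynomial (Option (Fin n)) L) := Polynomial.X - Polynomial.C W with hProot
  set Qroot : Polynomial (MvPolynomial (Option (Fin n)) L) :=
    ∑ i ∈ range j, Polynomial.X ^ i * Polynomial.C W ^ (j - 1 - i) with hQroot
  have hGrootEq : optionEquivLeft L (Option (Fin n)) Groot = Proot * Qroot := by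
    rw [hGroot, map_sub, map_pow, optionEquivLeft_X_none, optionEquivLeft_rename_some, hPhW,
      hProot, hQroot, mul_comm, geom_sum₂_mul, ← Polynomial.C_pow]
  set Phroot : MvPolynomial (Option (Option (Fin n))) L := X none - rename some W with hPhroot
  have hPhrootEq : optionEquivLeft L (Option (Fin n)) Phroot = Polynomial.C (C 1) * Proot := by
    rw [hPhroot, map_sub, optionEquivLeft_X_none, optionEquivLeft_rename_some, hProot, C_1,
      Polynomial.C_1, one_mul]
  have hProotM : Proot.Monic := Polynomial.monic_X_sub_C W
  have hS : ({c} : Finset L).card = Proot.natDegree := by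
    rw [card_singleton, hProot, Polynomial.natDegree_X_sub_C]
  have hroot : ∀ c' ∈ ({c} : Finset L), coeff 0 (Proot.eval (C c')) = 0 := by
    intro c' hc'
    rw [mem_singleton] at hc'
    rw [hc', hProot, Polynomial.eval_sub, Polynomial.eval_X, Polynomial.eval_C, coeff_sub, coeff_zero_C,
      ← constantCoeff_eq, ← hc, sub_self]
  have hQ : ∀ c' ∈ ({c} : Finset L), coeff 0 (Qroot.eval (C c')) ≠ 0 := by
    intro c' hc'
    rw [mem_singleton] at hc'
    rw [hc', hQroot, Polynomial.eval_finsetSum, ← constantCoeff_eq, map_sum]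
    have hterm : ∀ i ∈ range j, constantCoeff ((Polynomial.X ^ i * Polynomial.C W ^ (j - 1 - i)).eval
        (C c)) = c ^ (j - 1) := by
      intro i hi
      rw [mem_range] at hi
      rw [Polynomial.eval_mul, Polynomial.eval_pow, Polynomial.eval_pow, Polynomial.eval_X,
        Polynomial.eval_C, map_mul, map_pow, map_pow, constantCoeff_C, ← hc, ← pow_add]
      congr 1
      omega
    rw [sum_congr rfl hterm, sum_const, card_range, nsmul_eq_mul]
    exact mul_ne_zero hj (pow_ne_zero _ hc0)
  have hP' : ∀ c' ∈ ({c} : Finset L), coeff 0 ((Polynomial.derivative Proot).eval (C c')) ≠ 0 := by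
    intro c' _
    rw [hProot, Polynomial.derivative_X_sub_C, Polynomial.eval_one, coeff_zero_one]
    exact one_ne_zero
  have hPhrootdeg : Phroot.totalDegree ≤ d + 1 := by
    rw [hPhroot]
    refine (totalDegree_sub _ _).trans (max_le ?_ ?_)
    · exact (totalDegree_X _).le.trans (by omega)
    · exact ((totalDegree_rename_le _ _).trans hWdeg).trans (Nat.le_succ _)
  have hRoot := KaltofenFactor.complexity_le_of_rootData Groot Phroot 1 Proot Qroot hProotM hGrootEq
    hPhrootEq {c} hS hroot hQ hP' hPhrootdeg
  rw [card_singleton] at hRoot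
  have hGrootc : complexity Groot ≤ complexity Ph + d + 2 := by
    have hGr : Groot = X none ^ j + C (-1) * rename some Ph := by
      rw [hGroot, map_neg, map_one]; ring
    rw [hGr]
    calc _ ≤ complexity (X none ^ j : MvPolynomial (Option (Option (Fin n))) L) +
          complexity (C (-1) * rename some Ph : MvPolynomial (Option (Option (Fin n))) L) + 1 :=
          complexity_add_le_holds _ _
      _ ≤ j + (0 + complexity Ph + 1) + 1 := by
          gcongr
          · exact complexity_X_pow_le _ _
          · calc _ ≤ complexity (C (-1) : MvPolynomial (Option (Option (Fin n))) L) +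
                complexity (rename some Ph : MvPolynomial (Option (Option (Fin n))) L) + 1 :=
                complexity_mul_le_holds _ _
              _ ≤ 0 + complexity Ph + 1 := by
                  gcongr
                  · exact (complexity_C_holds _).le
                  · exact complexity_rename_le_holds' _ _
      _ ≤ complexity Ph + d + 2 := by omega
  have hWc : complexity W ≤ complexity Phroot + 1 := by
    have hWeq : W = C (-1) * aeval (fun o : Option (Option (Fin n)) => o.elim 0 X) Phroot := by
      rw [hPhroot, map_sub, aeval_X, Option.elim_none, aeval_rename]
      have : ((fun o : Option (Option (Fin n)) => o.elim (0 : MvPolynomial (Option (Fin n)) L) X) ∘ some)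
          = X := by funext o; rfl
      rw [this, aeval_X_left_apply, map_neg, map_one]
      ring
    rw [hWeq]
    calc _ ≤ complexity (C (-1) : MvPolynomial (Option (Fin n)) L) +
          complexity (aeval (fun o : Option (Option (Fin n)) => o.elim 0 X) Phroot) + 1 :=
          complexity_mul_le_holds _ _
      _ ≤ 0 + (complexity Phroot + 0) + 1 := by
          gcongr
          · exact (complexity_C_holds _).le
          · refine (complexity_aeval_le _ _).trans ?_
            gcongr
            refine (Finset.sum_eq_zero fun o _ => ?_).le
            rcases o with _ | o
            · rw [Option.elim_none, ← C_0, complexity_C_holds]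
            · rw [Option.elim_some, complexity_X_holds]
      _ = complexity Phroot + 1 := by ring
  -- 7. undo the substitution
  have hTarget : MvPolynomial.map ι (g ^ q) =
      aeval (fun o : Option (Fin n) => o.elim 0 fun i => X i - C ((v ∘ Sum.inr) i))
        (C (cg ^ q) * W) := by
    have h1 : C (cg ^ q) * W = sT (gL ^ q) := by
      rw [hWExp, mul_pow, ← C_pow, ← mul_assoc, ← C_mul, ← mul_pow, mul_inv_cancel₀ hcg0, one_pow,
        C_1, one_mul, map_pow]
    rw [h1, hsT, aeval_undo_shearTranslate, hgL, map_pow]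
  have hFinal : complexity (MvPolynomial.map ι (g ^ q)) ≤ complexity Phroot + n + 2 := by
    rw [hTarget]
    refine (complexity_undo_le _ _).trans ?_
    calc complexity (C (cg ^ q) * W) + n ≤ (complexity (C (cg ^ q) : MvPolynomial (Option (Fin n)) L)
          + complexity W + 1) + n := Nat.add_le_add_right (complexity_mul_le_holds _ _) _
      _ ≤ (0 + (complexity Phroot + 1) + 1) + n := by
          gcongr
          · exact (complexity_C_holds _).le
      _ = complexity Phroot + n + 2 := by ring
  -- 8. arithmetic
  refine hFinal.trans ?_
  rw [henselBound]
  have h2 : complexity Phroot ≤ (d + 1 + 2) ^ 2 * (1 * ((d + 1) * (complexity Groot + 2) + 2) + 1 + 1)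
      + (d + 1 + 1) := hRoot
  have h3 : complexity Groot ≤ ((d + 2) ^ 2 * (d * (2 * d * d * (d * ((complexity f + 3 * n + 1) + 5)
      + 1) + d * (d + 1) + 2) + 2 * d + 2) + (d + 1)) + d + 2 := by
    refine hGrootc.trans ?_
    gcongr
  have h4 : complexity Phroot ≤ (d + 3) ^ 2 * (1 * ((d + 1) * ((((d + 2) ^ 2 * (d * (2 * d * d *
      (d * ((complexity f + 3 * n + 1) + 5) + 1) + d * (d + 1) + 2) + 2 * d + 2) + (d + 1)) + d + 2)
        + 2) + 2) + 1 + 1) + (d + 1 + 1) := by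
    refine h2.trans ?_
    have : d + 1 + 2 = d + 3 := by ring
    rw [this]
    gcongr
  calc complexity Phroot + n + 2 ≤ (d + 3) ^ 2 * (1 * ((d + 1) * ((((d + 2) ^ 2 * (d * (2 * d * d *
      (d * ((complexity f + 3 * n + 1) + 5) + 1) + d * (d + 1) + 2) + 2 * d + 2) + (d + 1)) + d + 2)
        + 2) + 2) + 1 + 1) + (d + 1 + 1) + n + 2 := by gcongr
    _ = _ := by rfl

end Assembly

/-! ### Exponent bookkeeping -/

section Arith

/-- `a ≤ X` as `a ≤ X¹`. [folklore] -/
private theorem atom_le_pow {X a : ℕ} (ha : a ≤ X) : a ≤ X ^ 1 := by rwa [pow_one]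

/-- Constants are bounded by powers of `X ≥ 2`. [folklore] -/
private theorem const_le_pow {X c : ℕ} (m : ℕ) (hX : 2 ≤ X) (hc : c ≤ 2 ^ m) : c ≤ X ^ m :=
  hc.trans (Nat.pow_le_pow_left hX m)

/-- Products: exponents add. [folklore] -/
private theorem mul_le_pow {X a b i j : ℕ} (m : ℕ) (hX : 2 ≤ X) (ha : a ≤ X ^ i) (hb : b ≤ X ^ j)
    (h : i + j ≤ m) : a * b ≤ X ^ m :=
  calc a * b ≤ X ^ i * X ^ j := Nat.mul_le_mul ha hb
    _ = X ^ (i + j) := (pow_add _ _ _).symm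
    _ ≤ X ^ m := Nat.pow_le_pow_right (by omega) h

/-- Sums: one more than the larger exponent (`X ≥ 2`). [folklore] -/
private theorem add_le_pow {X a b i j : ℕ} (m : ℕ) (hX : 2 ≤ X) (ha : a ≤ X ^ i) (hb : b ≤ X ^ j)
    (hi : i < m) (hj : j < m) : a + b ≤ X ^ m := by
  obtain ⟨m', rfl⟩ : ∃ m', m = m' + 1 := ⟨m - 1, by omega⟩
  have ha' : a ≤ X ^ m' := ha.trans (Nat.pow_le_pow_right (by omega) (by omega))
  have hb' : b ≤ X ^ m' := hb.trans (Nat.pow_le_pow_right (by omega) (by omega))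
  calc a + b ≤ X ^ m' + X ^ m' := add_le_add ha' hb'
    _ = 2 * X ^ m' := by ring
    _ ≤ X * X ^ m' := Nat.mul_le_mul_right _ hX
    _ = X ^ (m' + 1) := by rw [pow_succ]; ring

/-- Squares. [folklore] -/
private theorem sq_le_pow {X a i : ℕ} (m : ℕ) (hX : 2 ≤ X) (ha : a ≤ X ^ i) (h : i + i ≤ m) :
    a ^ 2 ≤ X ^ m := by
  rw [sq]; exact mul_le_pow m hX ha ha h

/-- **The Hensel bound is polynomial**: `henselBound n s d ≤ X^38` for `X ≥ max(2, n, s, d)`.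
[folklore] -/
private theorem henselBound_le_pow {X n s d : ℕ} (hX : 2 ≤ X) (hn : n ≤ X) (hs : s ≤ X) (hd : d ≤ X) :
    henselBound n s d ≤ X ^ 38 := by
  have hd1 := atom_le_pow hd
  have hn1 := atom_le_pow hn
  have hs1 := atom_le_pow hs
  have c1 : (1 : ℕ) ≤ X ^ 0 := by rw [pow_zero]
  have c2 : (2 : ℕ) ≤ X ^ 1 := const_le_pow 1 hX (by norm_num)
  have c3 : (3 : ℕ) ≤ X ^ 2 := const_le_pow 2 hX (by norm_num)
  have c5 : (5 : ℕ) ≤ X ^ 3 := const_le_pow 3 hX (by norm_num)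
  have hA : s + 3 * n + 1 ≤ X ^ 5 :=
    add_le_pow 5 hX (add_le_pow 4 hX hs1 (mul_le_pow 3 hX c3 hn1 (by norm_num)) (by norm_num)
      (by norm_num)) c1 (by norm_num) (by norm_num)
  have hA5 : s + 3 * n + 1 + 5 ≤ X ^ 6 := add_le_pow 6 hX hA c5 (by norm_num) (by norm_num)
  have t2 : d * (s + 3 * n + 1 + 5) + 1 ≤ X ^ 8 :=
    add_le_pow 8 hX (mul_le_pow 7 hX hd1 hA5 (by norm_num)) c1 (by norm_num) (by norm_num)
  have t3 : 2 * d * d * (d * (s + 3 * n + 1 + 5) + 1) ≤ X ^ 11 :=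
    mul_le_pow 11 hX (mul_le_pow 3 hX (mul_le_pow 2 hX c2 hd1 (by norm_num)) hd1 (by norm_num)) t2
      (by norm_num)
  have hd2 : d + 1 ≤ X ^ 2 := add_le_pow 2 hX hd1 c1 (by norm_num) (by norm_num)
  have t4 : d * (d + 1) ≤ X ^ 3 := mul_le_pow 3 hX hd1 hd2 (by norm_num)
  have t5 : 2 * d * d * (d * (s + 3 * n + 1 + 5) + 1) + d * (d + 1) + 2 ≤ X ^ 13 :=
    add_le_pow 13 hX (add_le_pow 12 hX t3 t4 (by norm_num) (by norm_num)) c2 (by norm_num)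
      (by norm_num)
  have t7 : d * (2 * d * d * (d * (s + 3 * n + 1 + 5) + 1) + d * (d + 1) + 2) + 2 * d + 2 ≤ X ^ 16 :=
    add_le_pow 16 hX (add_le_pow 15 hX (mul_le_pow 14 hX hd1 t5 (by norm_num))
      (mul_le_pow 2 hX c2 hd1 (by norm_num)) (by norm_num) (by norm_num)) c2 (by norm_num) (by norm_num)
  have t8 : (d + 2) ^ 2 ≤ X ^ 4 :=
    sq_le_pow 4 hX (add_le_pow 2 hX hd1 c2 (by norm_num) (by norm_num)) (by norm_num)
  have E1 : (d + 2) ^ 2 * (d * (2 * d * d * (d * (s + 3 * n + 1 + 5) + 1) + d * (d + 1) + 2) +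
      2 * d + 2) + (d + 1) ≤ X ^ 21 :=
    add_le_pow 21 hX (mul_le_pow 20 hX t8 t7 (by norm_num)) hd2 (by norm_num) (by norm_num)
  have t9 : (d + 2) ^ 2 * (d * (2 * d * d * (d * (s + 3 * n + 1 + 5) + 1) + d * (d + 1) + 2) +
      2 * d + 2) + (d + 1) + d + 2 + 2 ≤ X ^ 24 :=
    add_le_pow 24 hX (add_le_pow 23 hX (add_le_pow 22 hX E1 hd1 (by norm_num) (by norm_num)) c2
      (by norm_num) (by norm_num)) c2 (by norm_num) (by norm_num)
  have t13 : 1 * ((d + 1) * ((d + 2) ^ 2 * (d * (2 * d * d * (d * (s + 3 * n + 1 + 5) + 1) +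
      d * (d + 1) + 2) + 2 * d + 2) + (d + 1) + d + 2 + 2) + 2) + 1 + 1 ≤ X ^ 29 :=
    add_le_pow 29 hX (add_le_pow 28 hX (mul_le_pow 27 hX c1 (add_le_pow 27 hX
      (mul_le_pow 26 hX hd2 t9 (by norm_num)) c2 (by norm_num) (by norm_num)) (by norm_num)) c1
        (by norm_num) (by norm_num)) c1 (by norm_num) (by norm_num)
  have t14 : (d + 3) ^ 2 ≤ X ^ 6 :=
    sq_le_pow 6 hX (add_le_pow 3 hX hd1 c3 (by norm_num) (by norm_num)) (by norm_num)
  have hd3 : d + 1 + 1 ≤ X ^ 3 := add_le_pow 3 hX hd2 c1 (by norm_num) (by norm_num)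
  have E2 : (d + 3) ^ 2 * (1 * ((d + 1) * ((d + 2) ^ 2 * (d * (2 * d * d * (d * (s + 3 * n + 1 + 5)
      + 1) + d * (d + 1) + 2) + 2 * d + 2) + (d + 1) + d + 2 + 2) + 2) + 1 + 1) + (d + 1 + 1)
        ≤ X ^ 36 :=
    add_le_pow 36 hX (mul_le_pow 35 hX t14 t13 (by norm_num)) hd3 (by norm_num) (by norm_num)
  rw [henselBound]
  exact add_le_pow 38 hX (add_le_pow 37 hX E2 hn1 (by norm_num) (by norm_num)) c2 (by norm_num)
    (by norm_num)

end Arith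

/-! ### The theorem over `𝔽_p` -/

section PrimeField

/-- **Kaltofen's factor theorem in positive characteristic (Bläser–Ikenmeyer–Jindal–Lysikov
2018, Thm. 24 = Kaltofen [Kal89] over `𝔽_p`, circuit-existence content), PROVED**: there is an
absolute `κ` (here `80`) such that for every prime `p`, every `n`, every nonzero
`f ∈ 𝔽_p[x_1, …, x_n]` and every irreducible `g` with `g^{p^e j} ∣ f`, `g^{p^e j + 1} ∤ f`,
`p ∤ j`: `L(g^{p^e}) ≤ (n + L(f) + deg f + log₂ p + 2)^κ`. This is exactly the statement typed as
`Literature.Barriers.ValiantsHypothesis.BIJL2018_thm24`. Proof: §§ above (genericity polynomial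
over `𝔽_p`, a good point and `deg f` nodes in `GaloisField p k` with `p^k > 2 (deg f + 1)²`,
Hensel lifting of `f = (g^{p^e})^j · h`, `j`-th root, and descent to `𝔽_p` by simulating
`GaloisField p k` as a `k`-dimensional `𝔽_p`-algebra).
[cite: Kaltofen1986, §2 and Thm. 2.1; BlaserIkenmeyerJindalLysikov2018, Thm. 24; HrubesYehudayoff2011, Thm 4.2] -/
theorem kaltofenFactorBound_primeChar :
    ∃ κ : ℕ, ∀ (p : ℕ) [Fact p.Prime] (n : ℕ) (f g : MvPolynomial (Fin n) (ZMod p)) (e j : ℕ),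
      f ≠ 0 → Irreducible g → ¬ p ∣ j → g ^ (p ^ e * j) ∣ f → ¬ g ^ (p ^ e * j + 1) ∣ f →
        complexity (g ^ p ^ e) ≤ (n + complexity f + f.totalDegree + Nat.log 2 p + 2) ^ κ := by
  refine ⟨80, ?_⟩
  intro p hp n f g e j hf0 hg hpj hdvd hndvd
  classical
  obtain ⟨h, hfh⟩ := hdvd
  have hh0 : h ≠ 0 := by rintro rfl; exact hf0 (by rw [hfh, mul_zero])
  have hgh : ¬ g ∣ h := by
    rintro ⟨h', rfl⟩
    exact hndvd ⟨h', by rw [hfh, pow_succ]; ring⟩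
  have hq1 : 1 ≤ p ^ e := Nat.one_le_pow _ _ hp.out.pos
  have hN1 : 1 ≤ p ^ e * j := by
    refine Nat.one_le_iff_ne_zero.2 (mul_ne_zero (by omega) ?_)
    rintro rfl; exact hpj (dvd_zero p)
  set d := f.totalDegree with hd
  -- degrees
  have hg0 : g ≠ 0 := hg.ne_zero
  have hdeq : d = p ^ e * j * g.totalDegree + h.totalDegree := by
    rw [hd, hfh, totalDegree_mul_of_isDomain (pow_ne_zero _ hg0) hh0, totalDegree_pow_of_ne_zero hg0]
  have hδd : g.totalDegree ≤ d := by
    rw [hdeq]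
    have := Nat.le_mul_of_pos_left g.totalDegree hN1
    omega
  have hηd : h.totalDegree ≤ d := by rw [hdeq]; omega
  -- the extension field
  set B := 2 * (d + 1) ^ 2 with hB
  have hBexp : B = 2 * (d * d) + 4 * d + 2 := by rw [hB]; ring
  set k := Nat.log p B + 1 with hk
  have hk0 : k ≠ 0 := Nat.succ_ne_zero _
  let 𝕃 := GaloisField p k
  haveI : Fintype 𝕃 := Fintype.ofFinite 𝕃
  have hcard : Fintype.card 𝕃 = p ^ k := by
    rw [← Nat.card_eq_fintype_card]; exact GaloisField.card p k hk0
  have hBlt : B < p ^ k := by rw [hk]; exact Nat.lt_pow_succ_log_self hp.out.one_lt B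
  have h𝔊deg : (genericityPoly g h).totalDegree < Fintype.card 𝕃 := by
    rw [hcard]
    refine lt_of_lt_of_le ?_ hBlt.le
    refine (totalDegree_genericityPoly_le g h).trans_lt ?_
    have h1 : g.totalDegree * h.totalDegree ≤ d * d := Nat.mul_le_mul hδd hηd
    rw [hBexp]
    nlinarith
  obtain ⟨v, hv⟩ := exists_aeval_ne_zero (𝕃 := 𝕃) (genericityPoly g h)
    (genericityPoly_ne_zero hg hh0 hgh) h𝔊deg
  have hdcard : Fintype.card (Fin d) ≤ Fintype.card 𝕃 := by
    rw [Fintype.card_fin, hcard]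
    have : d < B := by rw [hBexp]; nlinarith
    omega
  obtain ⟨emb⟩ := Function.Embedding.nonempty_of_card_le hdcard
  have hjL : ((j : ℕ) : 𝕃) ≠ 0 := by
    rw [Ne, CharP.cast_eq_zero_iff 𝕃 p]; exact hpj
  -- Kaltofen over the extension field
  have hmain := complexity_map_pow_le (L := 𝕃) f g h (p ^ e) j hq1 hjL hfh hg hh0 v hv rfl
    emb emb.injective
  -- descent
  obtain ⟨φ, hφ⟩ := LinearMap.exists_leftInverse_of_injective (Algebra.linearMap (ZMod p) 𝕃)
    (LinearMap.ker_eq_bot.2 (algebraMap (ZMod p) 𝕃).injective)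
  have hφ1 : φ 1 = 1 := by
    have := LinearMap.congr_fun hφ 1
    rwa [LinearMap.comp_apply, Algebra.linearMap_apply, map_one, LinearMap.id_apply] at this
  set bs := Module.finBasis (ZMod p) 𝕃 with hbs
  have hfin : Module.finrank (ZMod p) 𝕃 = k := GaloisField.finrank p hk0
  have hlmap : CommExtSim.lmap φ (C (1 : 𝕃) * MvPolynomial.map (algebraMap (ZMod p) 𝕃) (g ^ p ^ e)) =
      g ^ p ^ e := by
    rw [CommExtSim.lmap_C_mul_map, hφ1, one_smul]
  have hdesc := CommExtSim.complexity_lmap_le bs φ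
    (C (1 : 𝕃) * MvPolynomial.map (algebraMap (ZMod p) 𝕃) (g ^ p ^ e))
  rw [hlmap, Fintype.card_fin, hfin] at hdesc
  have hC1 : complexity (C (1 : 𝕃) * MvPolynomial.map (algebraMap (ZMod p) 𝕃) (g ^ p ^ e)) ≤
      henselBound n (complexity f) d + 1 := by
    calc _ ≤ complexity (C (1 : 𝕃) : MvPolynomial (Fin n) 𝕃) +
          complexity (MvPolynomial.map (algebraMap (ZMod p) 𝕃) (g ^ p ^ e)) + 1 :=
          complexity_mul_le_holds _ _
      _ ≤ 0 + henselBound n (complexity f) d + 1 := by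
          gcongr
          exact (complexity_C_holds _).le
      _ = _ := by ring
  -- arithmetic
  set X := n + complexity f + d + Nat.log 2 p + 2 with hX
  have hX2 : 2 ≤ X := by omega
  have hHB : henselBound n (complexity f) d ≤ X ^ 38 :=
    henselBound_le_pow hX2 (by omega) (by omega) (by omega)
  have hkB : k ≤ B + 1 := by rw [hk]; exact Nat.add_le_add_right (Nat.log_le_self _ _) _
  have hd2 : d + 1 ≤ X ^ 2 :=
    add_le_pow 2 hX2 (atom_le_pow (by omega)) (by rw [pow_zero]) (by norm_num) (by norm_num)
  have hkX : k ≤ X ^ 6 := by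
    refine hkB.trans ?_
    rw [hB]
    exact add_le_pow 6 hX2 (mul_le_pow 5 hX2 (const_le_pow 1 hX2 (by norm_num))
      (sq_le_pow 4 hX2 hd2 (by norm_num)) (by norm_num)) (by rw [pow_zero]) (by norm_num) (by norm_num)
  have hcoef : 5 * k ^ 3 + 6 * k ^ 2 + 2 * k ≤ X ^ 23 := by
    have hk3 : k ^ 3 ≤ X ^ 18 := by
      rw [pow_succ, sq]
      exact mul_le_pow 18 hX2 (mul_le_pow 12 hX2 hkX hkX (by norm_num)) hkX (by norm_num)
    exact add_le_pow 23 hX2 (add_le_pow 22 hX2 (mul_le_pow 21 hX2 (const_le_pow 3 hX2 (by norm_num))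
      hk3 (by norm_num)) (mul_le_pow 15 hX2 (const_le_pow 3 hX2 (by norm_num)) (sq_le_pow 12 hX2 hkX
        (by norm_num)) (by norm_num)) (by norm_num) (by norm_num)) (mul_le_pow 7 hX2
          (const_le_pow 1 hX2 (by norm_num)) hkX (by norm_num)) (by norm_num) (by norm_num)
  have hHB1 : henselBound n (complexity f) d + 1 ≤ X ^ 39 :=
    add_le_pow 39 hX2 hHB (by rw [pow_zero]) (by norm_num) (by norm_num)
  calc complexity (g ^ p ^ e)
      ≤ (5 * k ^ 3 + 6 * k ^ 2 + 2 * k) *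
          complexity (C (1 : 𝕃) * MvPolynomial.map (algebraMap (ZMod p) 𝕃) (g ^ p ^ e)) + 3 * k := hdesc
    _ ≤ (5 * k ^ 3 + 6 * k ^ 2 + 2 * k) * (henselBound n (complexity f) d + 1) + 3 * k := by
        gcongr
    _ ≤ X ^ 80 :=
        add_le_pow 80 hX2 (mul_le_pow 62 hX2 hcoef hHB1 (by norm_num))
          (mul_le_pow 8 hX2 (const_le_pow 2 hX2 (by norm_num)) hkX (by norm_num)) (by norm_num)
            (by norm_num)

end PrimeField

end KaltofenPosChar

end Literature.Computability.AlgebraicComplexity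

end
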